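import Mathlib
import Literature.Analysis.Complex.StripResidueFormula
import Literature.Analysis.SpecialFunctions.GammaStirlingOrder
import Literature.NumberTheory.Irrationality.BrownZudilin2022.BarnesRepresentation
import Literature.NumberTheory.Irrationality.BrownZudilin2022.CubicalSubstitutionProofs
import HarnessLib

/-!
# Brown–Zudilin 2022, Sect. 5, eq. (16): the Barnes-type double integral PROVED — Literature-side DISCHARGE of `barnes_double`

RE-HOMED into Literature (seat zeta5-irr-lit g8, 2026-08-27; HIDDEN-DISCHARGES sweep row `barnes_double`,
run/shared/lean/pub/bsd-rank2/lit/HIDDEN-DISCHARGES.md — a Literature named fact whose proof lived only under Summits/):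
this file is a verbatim proofs-only copy of the three files
`Summits/KontsevichZagierPeriods/Zeta5Search/BarnesMellin.lean`, `…/BarnesCube.lean`, `…/BarnesDouble.lean`
(cell `pub-zeta5`, seat ct-1 g11 — the authors of the mathematics), namespaces
`Summit.KontsevichZagierPeriods.Zeta5Search.{BarnesMellin, BarnesCube, BarnesDouble}` ↦
`Literature.NumberTheory.Irrationality.BrownZudilin2022.{BarnesMellin, BarnesCube, BarnesDouble}`, with the discharge
`Literature.NumberTheory.Irrationality.BrownZudilin2022.barnes_double_holds` declared in the fact's namespace so that
Literature importers can feed `(hF2 : barnes_double)` (the hypothesis carried by the cell's `WedgeDictionaryKernel{Cells,Atlas,Trans}*`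
files); cite tags added per declaration. Deviations from verbatim: the two three-line inputs `barnesPrefactor_pos`
(`WedgeDictionaryKernel.lean`) and `gamma_int_succ` (`WedgeDictionaryKernelCells.lean`) and the two-line `cpow_ofReal_pos`
(`Literature/Barriers/CriticalPhenomena/RigorousRGSmallParameterKatoFormula.lean`) are copied in rather than imported, and
`CubicalSubstitution.{openCube_eq_pi, measurableSet_openCube}` come from the already re-homed
`CubicalSubstitutionProofs.lean` (p484911). Theorems only: NO new definition, NO new named fact (net debt −1).

What is proved, as printed [BrownZudilin2022, Sect. 5, (16), p. 10]: for non-negative integer parameters `(p;q)` of the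
12-parameter integral (10) and every `(c₁,c₂)` in the `Chamber` of `BarnesRepresentation.lean`
(`0 < c₁ < 1+min{p₀,p₁,p₂}`, `0 < c₂ < 1+min{p₄,p₅,p₆}`, `c₁+c₂ > 1+p₀+p₆−q₃`, and the implicit `c₁+c₂ < p₃+2`),
the Barnes kernel is integrable on the pair of vertical lines `Re s = −c₁`, `Re t = −c₂` and
`J(p;q) = q₁!q₂!q₄!q₅!/(p₀!p₆!(p₃+q₃−p₀−p₆)!) · (1/2πi)² ∫∫ Γ(p₀+1+s)Γ(p₁+1+s)Γ(p₂+1+s)Γ(−s)/(Γ(p₁+q₁+2+s)Γ(p₂+q₂+2+s))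
 · Γ(p₄+1+t)Γ(p₅+1+t)Γ(p₆+1+t)Γ(−t)/(Γ(p₄+q₄+2+t)Γ(p₅+q₅+2+t)) · Γ(p₃+2+s+t)Γ(q₃−p₀−p₆−1−s−t) ds dt`.
Route = the paper's (p. 10): open the two denominators of (10)/(15) by the Barnes integral for a binomial
("Applying now the Barnes integral representation … where the vertical line Re s = −c separates the poles of Γ(−s) from
those of Γ(α_j+s)"), exchange the order of integration (Fubini; absolute convergence from the exponential decay of
`Γ(m+1+s)Γ(−s)` on vertical lines), and evaluate the cube integral by "the Eulerian integral
∫₀^∞ z^{α−1}(1+z)^{−α−β}dz = Γ(α)Γ(β)/Γ(α+β), where Re α, Re β > 0" (five Beta integrals).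
HONEST FRAMING (cell pub-zeta5 / zeta5-irr): nothing here is an irrationality result; no rung of the cell's ladder moves.

## References
* [BrownZudilin2022] F. Brown, W. Zudilin, *On cellular rational approximations to ζ(5)*, arXiv:2210.03391 (held text
  `paper:arxiv-2210.03391`; Sect. 5 read on the page by the re-homing seat: (15), the Barnes representation sentence, the
  Eulerian integral "where Re α, Re β > 0", (16) with its chamber inequalities).

The three original module headers follow verbatim.

## (1/3) `BarnesMellin.lean`
# ζ(5) search — the Mellin–Barnes integral for `(1+w)^{-(m+1)}` (cell `pub-zeta5`, seat ct-1 g11)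

HONEST FRAMING: systematic search; no irrationality claim unless kernel-certified. Nothing in this file is an
irrationality result, a worthiness exponent or a denominator statement. It is the analytic input of Brown–Zudilin's
derivation of the Barnes-type double integral (16) from the 12-parameter integral (10) [BrownZudilin2022, Sect. 5]:
"Applying now the Barnes integral representation … where the vertical line `Re s = −c` separates the poles of `Γ(−s)`
from those of `Γ(αⱼ+s)`", in the special case actually needed there (a `₁F₀`, i.e. a binomial):

* `mellin_barnes` — for real `w > 0`, `m : ℕ` and `0 < σ < m+1`,
  `(1+w)^{-(m+1)} = (1/2π) ∫_ℝ w^{s} Γ(m+1+s) Γ(−s) / m! dy`, `s = −σ + iy`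
  (Mathlib's Mellin inversion theorem `mellinInv_mellin_eq` applied to `t ↦ (1+t)^{-(m+1)}`, whose Mellin transform is
  the Beta integral `Γ(s)Γ(m+1−s)/m!`, `mellin_oneAdd_inv_pow`);
* `integrable_Gamma_vertical` / `integrable_Gamma_vertical'` — `y ↦ Γ(σ+iy)Γ(m+1−σ−iy)` is integrable on `ℝ`
  (reflection formula `Γ(s)Γ(1−s) = π/sin πs`, `|sin(x+iy)| ≥ |sinh y|`, hence exponential decay `e^{-(π-1)|y|}`).
Theorems only (no new definitions).

## (2/3) `BarnesCube.lean`
# ζ(5) search — Beta integrals over the open cube for Brown–Zudilin's `J(p;q)` (cell `pub-zeta5`, seat ct-1 g11)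

HONEST FRAMING: systematic search; no irrationality claim unless kernel-certified. Nothing in this file is an
irrationality result, a worthiness exponent or a denominator statement. It is the measure-theoretic half of the
derivation of Brown–Zudilin's Barnes-type double integral (16) from the 12-parameter integral (10)
[BrownZudilin2022, Sect. 5]: after the two denominators of (10) are opened by Mellin–Barnes integrals
(`BarnesMellin.lean`), the integral over `(0,1)⁵` FACTORISES into five Euler Beta integrals.

* `integral_openCube_prod5` / `integrable_openCube_prod5` — Fubini on `(0,1)⁵` for a product of one-variable functions;
* `integral_beta_Ioo`, `integrableOn_beta_Ioo` — `∫₀¹ x^{u−1}(1−x)^{v−1} dx = Γ(u)Γ(v)/Γ(u+v)` (Mathlib's Beta integral);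
* `zpow_ofReal_eq_exp` & co. — powers of positive reals as exponentials (for Laurent-monomial bookkeeping);
* `integrandJ_eq_factor` — on the cube, `1 − y₃(1−y₁y₂) = (1−y₃)(1 + y₃y₁y₂/(1−y₃))`, so the integrand of (10) is
  `R(y) · (1+w₁)^{-(p₀+1)} (1+w₂)^{-(p₆+1)}`;
* `cube_factorisation` — `R(y) w₁^s w₂^t` is a product of five Beta integrands, and `integral_cube_factor` — its integral
  over the cube is the corresponding product of Gamma quotients.

Theorems only (no new definitions).

## (3/3) `BarnesDouble.lean`
# ζ(5) search — Brown–Zudilin's Barnes-type double integral (16) PROVED: `barnes_double` holds (cell `pub-zeta5`, seat ct-1 g11)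

HONEST FRAMING: systematic search; no irrationality claim unless kernel-certified. Nothing in this file is an
irrationality result, a worthiness exponent or a denominator statement. It DISCHARGES the named Literature fact
`Literature.NumberTheory.Irrationality.BrownZudilin2022.barnes_double` [BrownZudilin2022, Sect. 5, eq. (16)]:
for non-negative integer parameters `(p;q)` and every `(c₁,c₂)` in the `Chamber`, the Barnes kernel is integrable on
the pair of vertical lines and `J(p;q) = q₁!q₂!q₄!q₅!/(p₀!p₆!(p₃+q₃−p₀−p₆)!) · (1/4π²) ∫∫ kernel`.

Route (the paper's, p. 10, with the two `₃F₂`'s left unnamed): open the two denominators of (10) by the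
Mellin–Barnes integral for a binomial (`BarnesMellin.mellin_barnes`, twice), exchange the order of integration
(Fubini on `(0,1)⁵ × ℝ²`, absolute convergence from the exponential decay of `Γ(m+1+s)Γ(−s)` on vertical lines and
the chamber inequalities), and evaluate the inner integral over the cube as a product of five Euler Beta integrals
(`BarnesCube.integral_cube_factor`); the Gamma factors then assemble to the printed kernel and prefactor
(`kernel_identity`). Consequence for the tree: the hypothesis `(hF2 : barnes_double)` of the gen-1 (H1)-free
cellular-relation files `WedgeDictionaryKernel{Cells,Atlas,Trans}*` is dischargeable by `barnes_double_holds`.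

Theorems only (no new definitions).
-/

noncomputable section

namespace Literature.NumberTheory.Irrationality.BrownZudilin2022.BarnesMellin

open MeasureTheory Set Filter Asymptotics
open scoped Topology Real

/-! ### 1. `Γ(s)Γ(m+1−s)` on a vertical line: product formula, exponential decay, integrability
(the elementary bounds `|sinh (Im z)| ≤ ‖sin z‖` and `e^u/4 ≤ sinh u` are the tree's
`Literature.Analysis.SpecialFunctions.abs_sinh_im_le_norm_sin` and `Literature.Analysis.Complex.exp_div_four_le_sinh`) -/

/-- Reflection + functional equation: `Γ(s)Γ(m+1−s) = (π / sin πs) ∏_{k<m} (k+1−s)` off the real axis.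
[cite: BrownZudilin2022, Sect. 5, p. 10 ("Applying now the Barnes integral representation … where the vertical line Re s = −c separates the poles of Γ(−s) from those of Γ(α_j+s)", between (15) and (16))] -/
theorem Gamma_mul_Gamma_nat_add_one_sub {s : ℂ} (hs : s.im ≠ 0) (m : ℕ) :
    Complex.Gamma s * Complex.Gamma ((m : ℂ) + 1 - s) =
      (π : ℂ) / Complex.sin (π * s) * ∏ k ∈ Finset.range m, ((k : ℂ) + 1 - s) := by
  induction m with
  | zero => simp [Complex.Gamma_mul_Gamma_one_sub]
  | succ m ih =>
    have hne : (m : ℂ) + 1 - s ≠ 0 := by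
      intro h
      have := congrArg Complex.im h
      simp at this
      exact hs this
    rw [Finset.prod_range_succ, show ((m + 1 : ℕ) : ℂ) + 1 - s = ((m : ℂ) + 1 - s) + 1 by push_cast; ring,
      Complex.Gamma_add_one _ hne, mul_left_comm, ih]
    ring

/-- Exponential decay on the vertical line `Re s = σ`, `|Im s| ≥ 1`:
`‖Γ(s)Γ(m+1−s)‖ ≤ 4π·m!·e^{m+|σ|}·e^{-(π-1)|y|}`.
[cite: BrownZudilin2022, Sect. 5, p. 10 ("Applying now the Barnes integral representation … where the vertical line Re s = −c separates the poles of Γ(−s) from those of Γ(α_j+s)", between (15) and (16))] -/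
theorem norm_Gamma_mul_Gamma_le (σ : ℝ) (m : ℕ) {y : ℝ} (hy : 1 ≤ |y|) :
    ‖Complex.Gamma ((σ : ℂ) + (y : ℂ) * Complex.I) * Complex.Gamma ((m : ℂ) + 1 - ((σ : ℂ) + (y : ℂ) * Complex.I))‖ ≤
      (4 * π * m.factorial * Real.exp (m + |σ|)) * Real.exp (-(π - 1) * |y|) := by
  set s : ℂ := (σ : ℂ) + (y : ℂ) * Complex.I with hs_def
  have him : s.im = y := by simp [hs_def]
  have hs : s.im ≠ 0 := by
    rw [him]; intro h; rw [h, abs_zero] at hy; linarith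
  rw [Gamma_mul_Gamma_nat_add_one_sub hs m, norm_mul, norm_div, Complex.norm_real, Real.norm_eq_abs,
    abs_of_pos Real.pi_pos]
  -- the sine
  have hsin : Real.exp (π * |y|) / 4 ≤ ‖Complex.sin (π * s)‖ := by
    have h1 := Literature.Analysis.SpecialFunctions.abs_sinh_im_le_norm_sin (π * s)
    have him' : ((π : ℂ) * s).im = π * y := by simp [hs_def]
    rw [him'] at h1
    have h2 : 1 ≤ |π * y| := by
      rw [abs_mul, abs_of_pos Real.pi_pos]; nlinarith [Real.pi_gt_three, hy, abs_nonneg y]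
    have h3 : Real.exp |π * y| / 4 ≤ |Real.sinh (π * y)| := by rw [Real.abs_sinh]; exact Literature.Analysis.Complex.exp_div_four_le_sinh h2
    rw [abs_mul, abs_of_pos Real.pi_pos] at h3
    exact h3.trans h1
  have hsin_pos : 0 < ‖Complex.sin (π * s)‖ := lt_of_lt_of_le (by positivity) hsin
  -- the polynomial
  have hnorm_s : ‖s‖ ≤ |σ| + |y| := by
    calc ‖s‖ ≤ ‖(σ : ℂ)‖ + ‖(y : ℂ) * Complex.I‖ := norm_add_le _ _
      _ = |σ| + |y| := by simp
  have hprod : ‖∏ k ∈ Finset.range m, ((k : ℂ) + 1 - s)‖ ≤ m.factorial * Real.exp (m + |σ| + |y|) := by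
    rw [norm_prod]
    have hk : ∀ k ∈ Finset.range m, ‖(k : ℂ) + 1 - s‖ ≤ m + |σ| + |y| := by
      intro k hk
      have hk' : (k : ℝ) + 1 ≤ m := by
        have := Finset.mem_range.mp hk
        exact_mod_cast this
      calc ‖(k : ℂ) + 1 - s‖ ≤ ‖(k : ℂ) + 1‖ + ‖s‖ := norm_sub_le _ _
        _ ≤ (k + 1) + (|σ| + |y|) := by
            gcongr
            rw [show (k : ℂ) + 1 = ((k + 1 : ℕ) : ℂ) by push_cast; ring, Complex.norm_natCast]
            push_cast; exact le_rfl
        _ ≤ m + |σ| + |y| := by linarith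
    calc ∏ k ∈ Finset.range m, ‖(k : ℂ) + 1 - s‖ ≤ ∏ _k ∈ Finset.range m, (m + |σ| + |y|) :=
          Finset.prod_le_prod (fun _ _ => norm_nonneg _) hk
      _ = (m + |σ| + |y|) ^ m := by simp
      _ ≤ m.factorial * Real.exp (m + |σ| + |y|) := by
          have h := Real.pow_div_factorial_le_exp (m + |σ| + |y|) (by positivity) m
          rw [div_le_iff₀ (by positivity)] at h
          linarith [h]
  -- combine
  have hpi : π / ‖Complex.sin (π * s)‖ ≤ π / (Real.exp (π * |y|) / 4) :=
    div_le_div_of_nonneg_left Real.pi_pos.le (by positivity) hsin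
  calc π / ‖Complex.sin (↑π * s)‖ * ‖∏ k ∈ Finset.range m, ((k : ℂ) + 1 - s)‖
      ≤ (π / (Real.exp (π * |y|) / 4)) * (m.factorial * Real.exp (m + |σ| + |y|)) :=
        mul_le_mul hpi hprod (norm_nonneg _) (by positivity)
    _ = (4 * π * m.factorial * Real.exp (m + |σ|)) * Real.exp (-(π - 1) * |y|) := by
        have e1 : Real.exp (m + |σ| + |y|) = Real.exp (m + |σ|) * Real.exp |y| := by rw [← Real.exp_add]
        have e2 : Real.exp (-(π - 1) * |y|) * Real.exp (π * |y|) = Real.exp |y| := by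
          rw [← Real.exp_add]; ring_nf
        have e3 : Real.exp (π * |y|) ≠ 0 := (Real.exp_pos _).ne'
        rw [e1, ← e2]; field_simp

/-- No poles on the line: `σ + iy ≠ −n` for `σ > 0`.
[cite: BrownZudilin2022, Sect. 5, p. 10 ("Applying now the Barnes integral representation … where the vertical line Re s = −c separates the poles of Γ(−s) from those of Γ(α_j+s)", between (15) and (16))] -/
theorem ne_neg_nat_of_re_pos {s : ℂ} (hs : 0 < s.re) (n : ℕ) : s ≠ -(n : ℂ) := by
  intro h
  have := congrArg Complex.re h
  simp at this
  linarith [n.cast_nonneg (α := ℝ)]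

/-- Continuity of `y ↦ Γ(σ+iy)Γ(m+1−σ−iy)` for `0 < σ < m+1`.
[cite: BrownZudilin2022, Sect. 5, p. 10 ("Applying now the Barnes integral representation … where the vertical line Re s = −c separates the poles of Γ(−s) from those of Γ(α_j+s)", between (15) and (16))] -/
theorem continuous_Gamma_vertical {σ : ℝ} (m : ℕ) (hσ : 0 < σ) (hσ' : σ < m + 1) :
    Continuous fun y : ℝ =>
      Complex.Gamma ((σ : ℂ) + (y : ℂ) * Complex.I) * Complex.Gamma ((m : ℂ) + 1 - ((σ : ℂ) + (y : ℂ) * Complex.I)) := by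
  have hc1 : Continuous fun y : ℝ => (σ : ℂ) + (y : ℂ) * Complex.I := by fun_prop
  have hc2 : Continuous fun y : ℝ => (m : ℂ) + 1 - ((σ : ℂ) + (y : ℂ) * Complex.I) := by fun_prop
  refine Continuous.mul ?_ ?_
  · refine continuous_iff_continuousAt.mpr fun y => (Complex.continuousAt_Gamma _ ?_).comp hc1.continuousAt
    exact ne_neg_nat_of_re_pos (by simp [hσ])
  · refine continuous_iff_continuousAt.mpr fun y => (Complex.continuousAt_Gamma _ ?_).comp hc2.continuousAt
    exact ne_neg_nat_of_re_pos (by simp; linarith)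

/-- `y ↦ e^{-b|y|}` is integrable on `ℝ` for `b > 0`.
[cite: BrownZudilin2022, Sect. 5, p. 10 ("Applying now the Barnes integral representation … where the vertical line Re s = −c separates the poles of Γ(−s) from those of Γ(α_j+s)", between (15) and (16))] -/
theorem integrable_exp_neg_mul_abs {b : ℝ} (hb : 0 < b) : Integrable fun y : ℝ => Real.exp (-b * |y|) := by
  have h1 : IntegrableOn (fun y : ℝ => Real.exp (-b * |y|)) (Ioi 0) := by
    refine (integrableOn_exp_mul_Ioi (show -b < 0 by linarith) 0).congr_fun (fun y hy => ?_) measurableSet_Ioi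
    rw [abs_of_pos (mem_Ioi.mp hy)]
  have h2 : IntegrableOn (fun y : ℝ => Real.exp (-b * |y|)) (Iic 0) := by
    refine (integrableOn_exp_mul_Iic hb 0).congr_fun (fun y hy => ?_) measurableSet_Iic
    rw [abs_of_nonpos (mem_Iic.mp hy)]; ring_nf
  have := h2.union h1
  rwa [Iic_union_Ioi, integrableOn_univ] at this

/-- A continuous function with an exponential tail bound is integrable on `ℝ`.
[cite: BrownZudilin2022, Sect. 5, p. 10 ("Applying now the Barnes integral representation … where the vertical line Re s = −c separates the poles of Γ(−s) from those of Γ(α_j+s)", between (15) and (16))] -/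
theorem integrable_of_norm_le_exp {F : ℝ → ℂ} (hF : Continuous F) {C b R : ℝ} (hb : 0 < b)
    (hbound : ∀ y : ℝ, R ≤ |y| → ‖F y‖ ≤ C * Real.exp (-b * |y|)) : Integrable F := by
  obtain ⟨M, hM⟩ := (isCompact_Icc : IsCompact (Icc (-|R|) |R|)).exists_bound_of_continuousOn hF.continuousOn
  set C' : ℝ := max C 0 + max M 0 * Real.exp (b * |R|) with hC'
  refine Integrable.mono' ((integrable_exp_neg_mul_abs hb).const_mul C') hF.aestronglyMeasurable
    (Eventually.of_forall fun y => ?_)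
  have hpos : 0 < Real.exp (-b * |y|) := Real.exp_pos _
  by_cases h : R ≤ |y|
  · calc ‖F y‖ ≤ C * Real.exp (-b * |y|) := hbound y h
      _ ≤ C' * Real.exp (-b * |y|) := by
          gcongr
          have : (0 : ℝ) ≤ max M 0 * Real.exp (b * |R|) := by positivity
          calc C ≤ max C 0 := le_max_left _ _
            _ ≤ C' := by rw [hC']; linarith
  · have h : |y| < R := not_le.mp h
    have hyI : y ∈ Icc (-|R|) |R| := by
      rw [mem_Icc]; constructor <;> cases abs_lt.mp (h.trans_le (le_abs_self R)) <;> linarith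
    have h1 : ‖F y‖ ≤ max M 0 := (hM y hyI).trans (le_max_left _ _)
    have h2 : (1 : ℝ) ≤ Real.exp (b * |R|) * Real.exp (-b * |y|) := by
      rw [← Real.exp_add]
      apply Real.one_le_exp
      have : |y| ≤ |R| := (h.trans_le (le_abs_self R)).le
      nlinarith
    calc ‖F y‖ ≤ max M 0 * (Real.exp (b * |R|) * Real.exp (-b * |y|)) := by
          nlinarith [le_max_right M 0]
      _ ≤ C' * Real.exp (-b * |y|) := by
          rw [hC']; nlinarith [le_max_right C 0, Real.exp_pos (b * |R|)]

/-- **Vertical integrability** of `y ↦ Γ(σ+iy)Γ(m+1−σ−iy)` for `0 < σ < m+1`.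
[cite: BrownZudilin2022, Sect. 5, p. 10 ("Applying now the Barnes integral representation … where the vertical line Re s = −c separates the poles of Γ(−s) from those of Γ(α_j+s)", between (15) and (16))] -/
theorem integrable_Gamma_vertical {σ : ℝ} (m : ℕ) (hσ : 0 < σ) (hσ' : σ < m + 1) :
    Integrable fun y : ℝ =>
      Complex.Gamma ((σ : ℂ) + (y : ℂ) * Complex.I) * Complex.Gamma ((m : ℂ) + 1 - ((σ : ℂ) + (y : ℂ) * Complex.I)) := by
  have hb : 0 < π - 1 := by linarith [Real.pi_gt_three]
  exact integrable_of_norm_le_exp (continuous_Gamma_vertical m hσ hσ') hb (R := 1)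
    (fun y hy => norm_Gamma_mul_Gamma_le σ m hy)

/-! ### 2. The Mellin transform of `t ↦ (1+t)^{-(m+1)}` is `Γ(s)Γ(m+1−s)/m!` -/

/-- Complex powers of a quotient of non-negative reals.
[cite: BrownZudilin2022, Sect. 5, p. 10 ("Applying now the Barnes integral representation … where the vertical line Re s = −c separates the poles of Γ(−s) from those of Γ(α_j+s)", between (15) and (16))] -/
theorem cpow_ofReal_div {a b : ℝ} (ha : 0 ≤ a) (hb : 0 < b) (z : ℂ) :
    (((a / b : ℝ)) : ℂ) ^ z = (a : ℂ) ^ z * (b : ℂ) ^ (-z) := by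
  rw [div_eq_mul_inv, Complex.ofReal_mul, Complex.mul_cpow_ofReal_nonneg ha (inv_nonneg.mpr hb.le),
    Complex.ofReal_inv, Complex.inv_cpow, Complex.cpow_neg]
  rw [Complex.arg_ofReal_of_nonneg hb.le]
  exact Real.pi_ne_zero.symm

/-- The map `x ↦ x/(1−x)` sends `(0,1)` onto `(0,∞)`.
[cite: BrownZudilin2022, Sect. 5, p. 10 ("Applying now the Barnes integral representation … where the vertical line Re s = −c separates the poles of Γ(−s) from those of Γ(α_j+s)", between (15) and (16))] -/
theorem image_div_one_sub : (fun x : ℝ => x / (1 - x)) '' Ioo (0 : ℝ) 1 = Ioi 0 := by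
  ext t
  constructor
  · rintro ⟨x, hx, rfl⟩
    exact div_pos hx.1 (by linarith [hx.2])
  · intro ht
    have ht' : (0 : ℝ) < t := ht
    refine ⟨t / (1 + t), ⟨div_pos ht' (by linarith), by rw [div_lt_one (by linarith)]; linarith⟩, ?_⟩
    have h1 : (1 : ℝ) + t ≠ 0 := by linarith
    field_simp
    ring

/-- `x ↦ x/(1−x)` is injective on `(0,1)`.
[cite: BrownZudilin2022, Sect. 5, p. 10 ("Applying now the Barnes integral representation … where the vertical line Re s = −c separates the poles of Γ(−s) from those of Γ(α_j+s)", between (15) and (16))] -/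
theorem injOn_div_one_sub : InjOn (fun x : ℝ => x / (1 - x)) (Ioo (0 : ℝ) 1) := by
  intro x hx x' hx' h
  have h1 : (1 : ℝ) - x ≠ 0 := by linarith [hx.2]
  have h2 : (1 : ℝ) - x' ≠ 0 := by linarith [hx'.2]
  simp only at h
  rw [div_eq_div_iff h1 h2] at h
  nlinarith

/-- Derivative of `x ↦ x/(1−x)` inside `(0,1)`.
[cite: BrownZudilin2022, Sect. 5, p. 10 ("Applying now the Barnes integral representation … where the vertical line Re s = −c separates the poles of Γ(−s) from those of Γ(α_j+s)", between (15) and (16))] -/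
theorem hasDerivWithinAt_div_one_sub {x : ℝ} (hx : x ∈ Ioo (0 : ℝ) 1) :
    HasDerivWithinAt (fun x : ℝ => x / (1 - x)) (1 / (1 - x) ^ 2) (Ioo (0 : ℝ) 1) x := by
  have h1 : (1 : ℝ) - x ≠ 0 := by linarith [hx.2]
  have h := (hasDerivAt_id x).div ((hasDerivAt_id x).const_sub 1) h1
  refine (h.congr_deriv ?_).hasDerivWithinAt
  simp only [id]
  field_simp
  ring

/-- The substituted Beta integrand: for `x ∈ (0,1)`,
`|1/(1−x)²| · (x/(1−x))^{s−1} · (1 + x/(1−x))^{-(m+1)} = x^{s−1}(1−x)^{(m+1−s)−1}`.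
[cite: BrownZudilin2022, Sect. 5, p. 10 ("Applying now the Barnes integral representation … where the vertical line Re s = −c separates the poles of Γ(−s) from those of Γ(α_j+s)", between (15) and (16))] -/
theorem subst_integrand {x : ℝ} (hx : x ∈ Ioo (0 : ℝ) 1) (s : ℂ) (m : ℕ) :
    |1 / (1 - x) ^ 2| • (((x / (1 - x) : ℝ) : ℂ) ^ (s - 1) * ((1 + ((x / (1 - x) : ℝ) : ℂ)) ^ (m + 1))⁻¹) =
      (x : ℂ) ^ (s - 1) * (1 - (x : ℂ)) ^ ((m : ℂ) + 1 - s - 1) := by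
  have hx0 : 0 < x := hx.1
  have hx1 : 0 < 1 - x := by linarith [hx.2]
  have hb : ((1 - x : ℝ) : ℂ) ≠ 0 := by exact_mod_cast hx1.ne'
  rw [cpow_ofReal_div hx0.le hx1 (s - 1)]
  have h1 : (1 : ℂ) + ((x / (1 - x) : ℝ) : ℂ) = (((1 - x : ℝ) : ℂ))⁻¹ := by
    rw [Complex.ofReal_div]
    field_simp
    push_cast; ring
  rw [h1, inv_pow, inv_inv, abs_of_pos (by positivity), Complex.real_smul]
  have e1 : (((1 / (1 - x) ^ 2 : ℝ)) : ℂ) = ((1 - x : ℝ) : ℂ) ^ (-(2 : ℂ)) := by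
    rw [Complex.cpow_neg, show (2 : ℂ) = ((2 : ℕ) : ℂ) by norm_num, Complex.cpow_natCast]
    push_cast; ring
  have e2 : (((1 - x : ℝ) : ℂ)) ^ (m + 1) = ((1 - x : ℝ) : ℂ) ^ (((m + 1 : ℕ)) : ℂ) :=
    (Complex.cpow_natCast _ _).symm
  rw [e1, e2]
  have e3 : ((1 - x : ℝ) : ℂ) ^ (-(2 : ℂ)) * ((x : ℂ) ^ (s - 1) * ((1 - x : ℝ) : ℂ) ^ (-(s - 1)) *
      ((1 - x : ℝ) : ℂ) ^ (((m + 1 : ℕ)) : ℂ)) =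
      (x : ℂ) ^ (s - 1) * (((1 - x : ℝ) : ℂ) ^ (-(2 : ℂ)) * ((1 - x : ℝ) : ℂ) ^ (-(s - 1)) *
        ((1 - x : ℝ) : ℂ) ^ (((m + 1 : ℕ)) : ℂ)) := by ring
  rw [e3, ← Complex.cpow_add _ _ hb, ← Complex.cpow_add _ _ hb,
    show (-(2 : ℂ) + -(s - 1) + ((m + 1 : ℕ) : ℂ)) = (m : ℂ) + 1 - s - 1 by push_cast; ring]
  push_cast
  rfl

/-- Continuity of `t ↦ (1+t)^{-(m+1)}` at every `t > -1`.
[cite: BrownZudilin2022, Sect. 5, p. 10 ("Applying now the Barnes integral representation … where the vertical line Re s = −c separates the poles of Γ(−s) from those of Γ(α_j+s)", between (15) and (16))] -/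
theorem continuousAt_oneAdd_inv_pow (m : ℕ) {t : ℝ} (ht : -1 < t) :
    ContinuousAt (fun t : ℝ => ((1 + (t : ℂ)) ^ (m + 1))⁻¹) t := by
  have hc : Continuous fun t : ℝ => (1 + (t : ℂ)) ^ (m + 1) := by fun_prop
  refine hc.continuousAt.inv₀ (pow_ne_zero _ ?_)
  have : (1 : ℂ) + (t : ℂ) = ((1 + t : ℝ) : ℂ) := by push_cast; ring
  rw [this]; exact_mod_cast (show (1 + t : ℝ) ≠ 0 by linarith)

/-- Norm of `(1+t)^{-(m+1)}` for `t > -1`.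
[cite: BrownZudilin2022, Sect. 5, p. 10 ("Applying now the Barnes integral representation … where the vertical line Re s = −c separates the poles of Γ(−s) from those of Γ(α_j+s)", between (15) and (16))] -/
theorem norm_oneAdd_inv_pow (m : ℕ) {t : ℝ} (ht : -1 < t) :
    ‖((1 + (t : ℂ)) ^ (m + 1))⁻¹‖ = ((1 + t) ^ (m + 1))⁻¹ := by
  rw [norm_inv, norm_pow, show (1 : ℂ) + (t : ℂ) = ((1 + t : ℝ) : ℂ) by push_cast; ring, Complex.norm_real,
    Real.norm_of_nonneg (by linarith)]

/-- The Mellin transform of `t ↦ (1+t)^{-(m+1)}` converges on `0 < Re s < m+1`.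
[cite: BrownZudilin2022, Sect. 5, p. 10 ("Applying now the Barnes integral representation … where the vertical line Re s = −c separates the poles of Γ(−s) from those of Γ(α_j+s)", between (15) and (16))] -/
theorem mellinConvergent_oneAdd_inv_pow (m : ℕ) {s : ℂ} (hs : 0 < s.re) (hs' : s.re < m + 1) :
    MellinConvergent (fun t : ℝ => ((1 + (t : ℂ)) ^ (m + 1))⁻¹) s := by
  have hcont : ContinuousOn (fun t : ℝ => ((1 + (t : ℂ)) ^ (m + 1))⁻¹) (Ioi 0) :=
    continuousOn_of_forall_continuousAt fun t ht =>
      continuousAt_oneAdd_inv_pow m (by linarith [mem_Ioi.mp ht])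
  refine mellinConvergent_of_isBigO_rpow (a := (m : ℝ) + 1) (b := 0)
    (hcont.locallyIntegrableOn measurableSet_Ioi) ?_ (by simpa using hs') ?_ (by simpa using hs)
  · refine IsBigO.of_bound 1 ?_
    filter_upwards [eventually_ge_atTop (1 : ℝ)] with x hx
    have hx0 : 0 < x := by linarith
    rw [norm_oneAdd_inv_pow m (by linarith), one_mul, Real.norm_of_nonneg (Real.rpow_nonneg hx0.le _),
      Real.rpow_neg hx0.le, show (m : ℝ) + 1 = ((m + 1 : ℕ) : ℝ) by push_cast; ring, Real.rpow_natCast]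
    exact inv_anti₀ (pow_pos hx0 _) (pow_le_pow_left₀ hx0.le (by linarith) _)
  · refine IsBigO.of_bound 1 ?_
    filter_upwards [self_mem_nhdsWithin] with x hx
    have hx0 : 0 < x := hx
    rw [norm_oneAdd_inv_pow m (by linarith), neg_zero, Real.rpow_zero, norm_one, mul_one]
    exact inv_le_one_of_one_le₀ (one_le_pow₀ (by linarith))

/-- **The Mellin transform of `(1+t)^{-(m+1)}`** is the Beta integral `Γ(s)Γ(m+1−s)/m!` on `0 < Re s < m+1`.
[cite: BrownZudilin2022, Sect. 5, p. 10 ("Applying now the Barnes integral representation … where the vertical line Re s = −c separates the poles of Γ(−s) from those of Γ(α_j+s)", between (15) and (16))] -/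
theorem mellin_oneAdd_inv_pow (m : ℕ) {s : ℂ} (hs : 0 < s.re) (hs' : s.re < m + 1) :
    mellin (fun t : ℝ => ((1 + (t : ℂ)) ^ (m + 1))⁻¹) s =
      Complex.Gamma s * Complex.Gamma ((m : ℂ) + 1 - s) / (m.factorial : ℂ) := by
  have hcv := integral_image_eq_integral_abs_deriv_smul measurableSet_Ioo
    (fun x hx => hasDerivWithinAt_div_one_sub hx) injOn_div_one_sub
    (fun t : ℝ => (t : ℂ) ^ (s - 1) • ((1 + (t : ℂ)) ^ (m + 1))⁻¹)
  rw [image_div_one_sub] at hcv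
  rw [mellin, hcv]
  have hpt : ∀ x ∈ Ioo (0 : ℝ) 1,
      |1 / (1 - x) ^ 2| • (((x / (1 - x) : ℝ) : ℂ) ^ (s - 1) • ((1 + ((x / (1 - x) : ℝ) : ℂ)) ^ (m + 1))⁻¹) =
        (x : ℂ) ^ (s - 1) * (1 - (x : ℂ)) ^ ((m : ℂ) + 1 - s - 1) := by
    intro x hx
    rw [smul_eq_mul]
    exact subst_integrand hx s m
  rw [setIntegral_congr_fun measurableSet_Ioo hpt]
  have hB : ∫ x in Ioo (0 : ℝ) 1, (x : ℂ) ^ (s - 1) * (1 - (x : ℂ)) ^ ((m : ℂ) + 1 - s - 1) =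
      Complex.betaIntegral s ((m : ℂ) + 1 - s) := by
    rw [Complex.betaIntegral, intervalIntegral.integral_of_le zero_le_one, integral_Ioc_eq_integral_Ioo]
  rw [hB]
  have hre : 0 < ((m : ℂ) + 1 - s).re := by simp; linarith
  have key := Complex.Gamma_mul_Gamma_eq_betaIntegral hs hre
  rw [show s + ((m : ℂ) + 1 - s) = (m : ℂ) + 1 by ring, Complex.Gamma_nat_eq_factorial] at key
  have hm : (m.factorial : ℂ) ≠ 0 := by exact_mod_cast m.factorial_ne_zero
  rw [eq_div_iff hm, mul_comm, key]

/-! ### 3. The Mellin–Barnes integral -/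

/-- Vertical integrability of the Mellin transform of `(1+t)^{-(m+1)}` on `Re s = σ ∈ (0, m+1)`.
[cite: BrownZudilin2022, Sect. 5, p. 10 ("Applying now the Barnes integral representation … where the vertical line Re s = −c separates the poles of Γ(−s) from those of Γ(α_j+s)", between (15) and (16))] -/
theorem verticalIntegrable_mellin_oneAdd_inv_pow (m : ℕ) {σ : ℝ} (hσ : 0 < σ) (hσ' : σ < m + 1) :
    Complex.VerticalIntegrable (mellin fun t : ℝ => ((1 + (t : ℂ)) ^ (m + 1))⁻¹) σ := by
  unfold Complex.VerticalIntegrable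
  have heq : (fun y : ℝ => mellin (fun t : ℝ => ((1 + (t : ℂ)) ^ (m + 1))⁻¹) ((σ : ℂ) + (y : ℂ) * Complex.I)) =
      fun y : ℝ => Complex.Gamma ((σ : ℂ) + (y : ℂ) * Complex.I) *
        Complex.Gamma ((m : ℂ) + 1 - ((σ : ℂ) + (y : ℂ) * Complex.I)) / (m.factorial : ℂ) := by
    funext y
    exact mellin_oneAdd_inv_pow m (by simpa using hσ) (by simpa using hσ')
  rw [heq]
  exact (integrable_Gamma_vertical m hσ hσ').div_const _

/-- **Mellin–Barnes integral for a binomial** [BrownZudilin2022, Sect. 5, "Barnes integral representation", case `₁F₀`]: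
for real `w > 0`, `m : ℕ`, `0 < σ < m+1`,
`(1+w)^{-(m+1)} = (1/2π) ∫_ℝ w^{s} Γ(m+1+s)Γ(−s)/m! dy` with `s = −σ+iy` (the line `Re s = −σ` separates the poles of
`Γ(−s)` from those of `Γ(m+1+s)`).
[cite: BrownZudilin2022, Sect. 5, p. 10 ("Applying now the Barnes integral representation … where the vertical line Re s = −c separates the poles of Γ(−s) from those of Γ(α_j+s)", between (15) and (16))] -/
theorem mellin_barnes (m : ℕ) {w σ : ℝ} (hw : 0 < w) (hσ : 0 < σ) (hσ' : σ < m + 1) :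
    ((1 + (w : ℂ)) ^ (m + 1))⁻¹ =
      (1 / (2 * π) : ℂ) * ∫ y : ℝ, (w : ℂ) ^ (-(σ : ℂ) + (y : ℂ) * Complex.I) *
        (Complex.Gamma ((m : ℂ) + 1 + (-(σ : ℂ) + (y : ℂ) * Complex.I)) *
          Complex.Gamma (-(-(σ : ℂ) + (y : ℂ) * Complex.I)) / (m.factorial : ℂ)) := by
  set f : ℝ → ℂ := fun t => ((1 + (t : ℂ)) ^ (m + 1))⁻¹ with hf
  have hinv := mellinInv_mellin_eq σ f hw (mellinConvergent_oneAdd_inv_pow m (by simpa using hσ)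
    (by simpa using hσ')) (verticalIntegrable_mellin_oneAdd_inv_pow m hσ hσ') (continuousAt_oneAdd_inv_pow m (by linarith))
  rw [show ((1 + (w : ℂ)) ^ (m + 1))⁻¹ = f w from rfl, ← hinv, mellinInv, Complex.real_smul]
  push_cast
  congr 1
  set B : ℝ → ℂ := fun y => (w : ℂ) ^ (-(σ : ℂ) + (y : ℂ) * Complex.I) *
        (Complex.Gamma ((m : ℂ) + 1 + (-(σ : ℂ) + (y : ℂ) * Complex.I)) *
          Complex.Gamma (-(-(σ : ℂ) + (y : ℂ) * Complex.I)) / (m.factorial : ℂ)) with hB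
  have hA : ∀ y : ℝ, (w : ℂ) ^ (-((σ : ℂ) + (y : ℂ) * Complex.I)) • mellin f ((σ : ℂ) + (y : ℂ) * Complex.I) = B (-y) := by
    intro y
    rw [mellin_oneAdd_inv_pow m (by simpa using hσ) (by simpa using hσ'), smul_eq_mul, hB]
    simp only [Complex.ofReal_neg]
    rw [show -(σ : ℂ) + -(y : ℂ) * Complex.I = -((σ : ℂ) + (y : ℂ) * Complex.I) by ring,
      show (m : ℂ) + 1 + -((σ : ℂ) + (y : ℂ) * Complex.I) = (m : ℂ) + 1 - ((σ : ℂ) + (y : ℂ) * Complex.I) by ring,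
      neg_neg]
    ring
  calc ∫ y : ℝ, (w : ℂ) ^ (-((σ : ℂ) + (y : ℂ) * Complex.I)) • mellin f ((σ : ℂ) + (y : ℂ) * Complex.I)
      = ∫ y : ℝ, B (-y) := by congr 1; funext y; exact hA y
    _ = ∫ y : ℝ, B y := integral_neg_eq_self B volume

/-- The weight `Γ(m+1+s)Γ(−s)`, `s = −σ+iy`, is integrable in `y` …
[cite: BrownZudilin2022, Sect. 5, p. 10 ("Applying now the Barnes integral representation … where the vertical line Re s = −c separates the poles of Γ(−s) from those of Γ(α_j+s)", between (15) and (16))] -/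
theorem integrable_Gamma_vertical' (m : ℕ) {σ : ℝ} (hσ : 0 < σ) (hσ' : σ < m + 1) :
    Integrable fun y : ℝ => Complex.Gamma ((m : ℂ) + 1 + (-(σ : ℂ) + (y : ℂ) * Complex.I)) *
      Complex.Gamma (-(-(σ : ℂ) + (y : ℂ) * Complex.I)) := by
  have h := (integrable_Gamma_vertical m hσ hσ').comp_neg
  refine h.congr (Eventually.of_forall fun y => ?_)
  simp only [Complex.ofReal_neg]
  rw [show (m : ℂ) + 1 + (-(σ : ℂ) + (y : ℂ) * Complex.I) = (m : ℂ) + 1 - ((σ : ℂ) + -(y : ℂ) * Complex.I) by ring,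
    show -(-(σ : ℂ) + (y : ℂ) * Complex.I) = (σ : ℂ) + -(y : ℂ) * Complex.I by ring, mul_comm]

/-- … and continuous in `y`.
[cite: BrownZudilin2022, Sect. 5, p. 10 ("Applying now the Barnes integral representation … where the vertical line Re s = −c separates the poles of Γ(−s) from those of Γ(α_j+s)", between (15) and (16))] -/
theorem continuous_Gamma_vertical' (m : ℕ) {σ : ℝ} (hσ : 0 < σ) (hσ' : σ < m + 1) :
    Continuous fun y : ℝ => Complex.Gamma ((m : ℂ) + 1 + (-(σ : ℂ) + (y : ℂ) * Complex.I)) *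
      Complex.Gamma (-(-(σ : ℂ) + (y : ℂ) * Complex.I)) := by
  have h := (continuous_Gamma_vertical m hσ hσ').comp continuous_neg
  refine h.congr fun y => ?_
  simp only [Function.comp, Complex.ofReal_neg]
  rw [show (m : ℂ) + 1 + (-(σ : ℂ) + (y : ℂ) * Complex.I) = (m : ℂ) + 1 - ((σ : ℂ) + -(y : ℂ) * Complex.I) by ring,
    show -(-(σ : ℂ) + (y : ℂ) * Complex.I) = (σ : ℂ) + -(y : ℂ) * Complex.I by ring, mul_comm]

end Literature.NumberTheory.Irrationality.BrownZudilin2022.BarnesMellin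

namespace Literature.NumberTheory.Irrationality.BrownZudilin2022.BarnesCube

open MeasureTheory Set Filter
open scoped Topology Real
open Literature.NumberTheory.Irrationality.BrownZudilin2022
open Literature.NumberTheory.Irrationality.BrownZudilin2022.CubicalSubstitution (openCube_eq_pi measurableSet_openCube)

/-- Complex power of a positive real as an exponential: `x^z = exp(z log x)`. [folklore] -/
private theorem cpow_ofReal_pos {x : ℝ} (hx : 0 < x) (z : ℂ) :
    (x : ℂ) ^ z = Complex.exp (z * (Real.log x : ℂ)) := by
  rw [Complex.cpow_def_of_ne_zero (Complex.ofReal_ne_zero.2 hx.ne'), ← Complex.ofReal_log hx.le, mul_comm]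

/-! ### 1. Fubini on the open cube for products of one-variable functions -/

/-- `∫_{(0,1)⁵} f₀(y₀)f₁(y₁)f₂(y₂)f₃(y₃)f₄(y₄) dy = ∏ᵢ ∫₀¹ fᵢ`.
[cite: BrownZudilin2022, Sect. 5, (15) and p. 10 ("the Eulerian integral ∫₀^∞ z^(α−1) (1+z)^(−α−β) dz = Γ(α)Γ(β)/Γ(α+β), where Re α, Re β > 0")] -/
theorem integral_openCube_prod5 (f0 f1 f2 f3 f4 : ℝ → ℂ) :
    ∫ y in openCube, f0 (y 0) * f1 (y 1) * f2 (y 2) * f3 (y 3) * f4 (y 4) =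
      (∫ x in Ioo (0:ℝ) 1, f0 x) * (∫ x in Ioo (0:ℝ) 1, f1 x) * (∫ x in Ioo (0:ℝ) 1, f2 x) *
        (∫ x in Ioo (0:ℝ) 1, f3 x) * (∫ x in Ioo (0:ℝ) 1, f4 x) := by
  have h := integral_fintype_prod_eq_prod (𝕜 := ℂ) (![f0, f1, f2, f3, f4] : Fin 5 → ℝ → ℂ)
    (μ := fun _ : Fin 5 => (volume : Measure ℝ).restrict (Ioo 0 1))
  simp only [Fin.prod_univ_five, Matrix.cons_val_zero, Matrix.cons_val_one, Matrix.cons_val] at h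
  rw [openCube_eq_pi, volume_pi, Measure.restrict_pi_pi]
  exact h

/-- A product of five functions integrable on `(0,1)` is integrable on the open cube.
[cite: BrownZudilin2022, Sect. 5, (15) and p. 10 ("the Eulerian integral ∫₀^∞ z^(α−1) (1+z)^(−α−β) dz = Γ(α)Γ(β)/Γ(α+β), where Re α, Re β > 0")] -/
theorem integrable_openCube_prod5 {f0 f1 f2 f3 f4 : ℝ → ℂ} (h0 : IntegrableOn f0 (Ioo 0 1)) (h1 : IntegrableOn f1 (Ioo 0 1))
    (h2 : IntegrableOn f2 (Ioo 0 1)) (h3 : IntegrableOn f3 (Ioo 0 1)) (h4 : IntegrableOn f4 (Ioo 0 1)) :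
    IntegrableOn (fun y : Fin 5 → ℝ => f0 (y 0) * f1 (y 1) * f2 (y 2) * f3 (y 3) * f4 (y 4)) openCube := by
  have h := Integrable.fintype_prod (f := (![f0, f1, f2, f3, f4] : Fin 5 → ℝ → ℂ))
    (μ := fun _ : Fin 5 => (volume : Measure ℝ).restrict (Ioo 0 1)) (by
      intro i; fin_cases i <;> assumption)
  simp only [Fin.prod_univ_five, Matrix.cons_val_zero, Matrix.cons_val_one, Matrix.cons_val] at h
  rw [IntegrableOn, openCube_eq_pi, volume_pi, Measure.restrict_pi_pi]
  exact h

/-! ### 2. Euler's Beta integral on `(0,1)` -/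

/-- `∫₀¹ x^{u−1}(1−x)^{v−1} dx = Γ(u)Γ(v)/Γ(u+v)` for `Re u, Re v > 0` (as a set integral over `Ioo 0 1`).
[cite: BrownZudilin2022, Sect. 5, (15) and p. 10 ("the Eulerian integral ∫₀^∞ z^(α−1) (1+z)^(−α−β) dz = Γ(α)Γ(β)/Γ(α+β), where Re α, Re β > 0")] -/
theorem integral_beta_Ioo {u v : ℂ} (hu : 0 < u.re) (hv : 0 < v.re) :
    ∫ x in Ioo (0:ℝ) 1, (x : ℂ) ^ (u - 1) * (1 - (x : ℂ)) ^ (v - 1) =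
      Complex.Gamma u * Complex.Gamma v / Complex.Gamma (u + v) := by
  have hB : ∫ x in Ioo (0:ℝ) 1, (x : ℂ) ^ (u - 1) * (1 - (x : ℂ)) ^ (v - 1) = Complex.betaIntegral u v := by
    rw [Complex.betaIntegral, intervalIntegral.integral_of_le zero_le_one, integral_Ioc_eq_integral_Ioo]
  rw [hB, Complex.Gamma_mul_Gamma_eq_betaIntegral hu hv, mul_div_cancel_left₀]
  apply Complex.Gamma_ne_zero
  intro n h
  have := congrArg Complex.re h
  simp at this
  linarith [n.cast_nonneg (α := ℝ)]

/-- The Beta integrand is integrable on `(0,1)` for `Re u, Re v > 0`.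
[cite: BrownZudilin2022, Sect. 5, (15) and p. 10 ("the Eulerian integral ∫₀^∞ z^(α−1) (1+z)^(−α−β) dz = Γ(α)Γ(β)/Γ(α+β), where Re α, Re β > 0")] -/
theorem integrableOn_beta_Ioo {u v : ℂ} (hu : 0 < u.re) (hv : 0 < v.re) :
    IntegrableOn (fun x : ℝ => (x : ℂ) ^ (u - 1) * (1 - (x : ℂ)) ^ (v - 1)) (Ioo 0 1) := by
  have h := (Complex.betaIntegral_convergent hu hv).1
  -- `IntervalIntegrable … 0 1` gives integrability on `Ioc 0 1 ⊇ Ioo 0 1`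
  exact h.mono_set Ioo_subset_Ioc_self

/-! ### 3. Complex powers of positive reals as exponentials
(`(x:ℂ)^z = exp(z log x)` for `x > 0` is the tree's `Literature.Barriers.CriticalPhenomena.LongRangePhi4.Kato.cpow_ofReal_pos`) -/

/-- For real `x > 0` and an integer `n`: `((x^n : ℝ) : ℂ) = exp(n · log x)`.
[cite: BrownZudilin2022, Sect. 5, (15) and p. 10 ("the Eulerian integral ∫₀^∞ z^(α−1) (1+z)^(−α−β) dz = Γ(α)Γ(β)/Γ(α+β), where Re α, Re β > 0")] -/
theorem zpow_ofReal_eq_exp {x : ℝ} (hx : 0 < x) (n : ℤ) :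
    ((x ^ n : ℝ) : ℂ) = Complex.exp ((n : ℂ) * (Real.log x : ℂ)) := by
  rw [Complex.ofReal_zpow, ← Complex.cpow_intCast, cpow_ofReal_pos hx]

/-- For real `x > 0` and a natural `n`: `((x^n : ℝ) : ℂ) = exp(n · log x)`.
[cite: BrownZudilin2022, Sect. 5, (15) and p. 10 ("the Eulerian integral ∫₀^∞ z^(α−1) (1+z)^(−α−β) dz = Γ(α)Γ(β)/Γ(α+β), where Re α, Re β > 0")] -/
theorem pow_ofReal_eq_exp {x : ℝ} (hx : 0 < x) (n : ℕ) :
    ((x ^ n : ℝ) : ℂ) = Complex.exp ((n : ℂ) * (Real.log x : ℂ)) := by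
  rw [Complex.ofReal_pow, ← Complex.cpow_natCast, cpow_ofReal_pos hx]

/-- `1 - (x:ℂ)` as the cast of the positive real `1 - x` in exponential form, for `x < 1`.
[cite: BrownZudilin2022, Sect. 5, (15) and p. 10 ("the Eulerian integral ∫₀^∞ z^(α−1) (1+z)^(−α−β) dz = Γ(α)Γ(β)/Γ(α+β), where Re α, Re β > 0")] -/
theorem one_sub_cpow_eq_exp {x : ℝ} (hx : x < 1) (z : ℂ) :
    (1 - (x : ℂ)) ^ z = Complex.exp (z * (Real.log (1 - x) : ℂ)) := by
  rw [show (1 : ℂ) - (x : ℂ) = ((1 - x : ℝ) : ℂ) by push_cast; ring, cpow_ofReal_pos (by linarith)]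


/-- Shifted form: `∫₀¹ x^{a}(1−x)^{b} dx = Γ(a+1)Γ(b+1)/Γ(a+b+2)` for `Re a, Re b > −1`.
[cite: BrownZudilin2022, Sect. 5, (15) and p. 10 ("the Eulerian integral ∫₀^∞ z^(α−1) (1+z)^(−α−β) dz = Γ(α)Γ(β)/Γ(α+β), where Re α, Re β > 0")] -/
theorem integral_beta_Ioo' {a b : ℂ} (ha : -1 < a.re) (hb : -1 < b.re) :
    ∫ x in Ioo (0:ℝ) 1, (x : ℂ) ^ a * (1 - (x : ℂ)) ^ b =
      Complex.Gamma (a + 1) * Complex.Gamma (b + 1) / Complex.Gamma (a + b + 2) := by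
  have h := integral_beta_Ioo (u := a + 1) (v := b + 1) (by simp; linarith) (by simp; linarith)
  simp only [add_sub_cancel_right] at h
  rw [h]; congr 2; ring

/-- Shifted form of the integrability of the Beta integrand.
[cite: BrownZudilin2022, Sect. 5, (15) and p. 10 ("the Eulerian integral ∫₀^∞ z^(α−1) (1+z)^(−α−β) dz = Γ(α)Γ(β)/Γ(α+β), where Re α, Re β > 0")] -/
theorem integrableOn_beta_Ioo' {a b : ℂ} (ha : -1 < a.re) (hb : -1 < b.re) :
    IntegrableOn (fun x : ℝ => (x : ℂ) ^ a * (1 - (x : ℂ)) ^ b) (Ioo 0 1) := by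
  have h := integrableOn_beta_Ioo (u := a + 1) (v := b + 1) (by simp; linarith) (by simp; linarith)
  simp only [add_sub_cancel_right] at h
  exact h

/-! ### 4. The integrand of (10) on the cube: opening the two denominators -/

/-- Pure algebra: `N/((aA)^k (aB)^l) = N/(a^k a^l) · (A^k)⁻¹ (B^l)⁻¹`.
[cite: BrownZudilin2022, Sect. 5, (15) and p. 10 ("the Eulerian integral ∫₀^∞ z^(α−1) (1+z)^(−α−β) dz = Γ(α)Γ(β)/Γ(α+β), where Re α, Re β > 0")] -/
theorem div_mul_pow_aux (N a A B : ℝ) (k l : ℕ) (ha : a ≠ 0) (hA : A ≠ 0) (hB : B ≠ 0) :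
    N / ((a * A) ^ k * (a * B) ^ l) = N / (a ^ k * a ^ l) * ((A ^ k)⁻¹ * (B ^ l)⁻¹) := by
  rw [mul_pow, mul_pow]
  field_simp

/-- **Opening the denominators of (10).** On the open cube, with `w₁ = y₃y₁y₂/(1−y₃)`, `w₂ = y₃y₄y₅/(1−y₃)`
(indices as in `integrandJ`: `y 2` is the printed `y₃`): `1 − y₃(1−y₁y₂) = (1−y₃)(1+w₁)` etc., hence
`integrandJ p q y = R(y) · (1+w₁)^{-(p₀+1)} (1+w₂)^{-(p₆+1)}`. [BrownZudilin2022, Sect. 5, "observing that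
`1−y₃(1−y₁y₂) = (1 + y₃/(1−y₃) y₁y₂)(1−y₃)`"]
[cite: BrownZudilin2022, Sect. 5, (15) and p. 10 ("the Eulerian integral ∫₀^∞ z^(α−1) (1+z)^(−α−β) dz = Γ(α)Γ(β)/Γ(α+β), where Re α, Re β > 0")] -/
theorem integrandJ_eq_factor (p : Fin 7 → ℤ) (q : Fin 5 → ℤ) {m₀ m₆ : ℕ} (hp0 : p 0 = m₀) (hp6 : p 6 = m₆)
    {y : Fin 5 → ℝ} (hy : y ∈ openCube) :
    integrandJ p q y =
      (y 0 ^ (p 1) * (1 - y 0) ^ (q 0) * y 1 ^ (p 2) * (1 - y 1) ^ (q 1) * y 2 ^ (p 3 + 1) * (1 - y 2) ^ (q 2) *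
          y 3 ^ (p 4) * (1 - y 3) ^ (q 3) * y 4 ^ (p 5) * (1 - y 4) ^ (q 4) /
          ((1 - y 2) ^ (m₀ + 1) * (1 - y 2) ^ (m₆ + 1))) *
        (((1 + y 2 * (y 0 * y 1) / (1 - y 2)) ^ (m₀ + 1))⁻¹ * ((1 + y 2 * (y 3 * y 4) / (1 - y 2)) ^ (m₆ + 1))⁻¹) := by
  have h0 := (hy 0).1; have h1 := (hy 1).1; have h3 := (hy 3).1; have h4 := (hy 4).1
  have h2 := (hy 2).1
  have h2' : 0 < 1 - y 2 := by linarith [(hy 2).2]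
  have e1 : 1 - y 2 * (1 - y 0 * y 1) = (1 - y 2) * (1 + y 2 * (y 0 * y 1) / (1 - y 2)) := by
    field_simp; ring
  have e2 : 1 - y 2 * (1 - y 3 * y 4) = (1 - y 2) * (1 + y 2 * (y 3 * y 4) / (1 - y 2)) := by
    field_simp; ring
  have hA : (1 + y 2 * (y 0 * y 1) / (1 - y 2)) ≠ 0 := by positivity
  have hB : (1 + y 2 * (y 3 * y 4) / (1 - y 2)) ≠ 0 := by positivity
  unfold integrandJ
  rw [e1, e2, hp0, hp6, show ((m₀ : ℤ) + 1) = ((m₀ + 1 : ℕ) : ℤ) by push_cast; ring,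
    show ((m₆ : ℤ) + 1) = ((m₆ + 1 : ℕ) : ℤ) by push_cast; ring, zpow_natCast, zpow_natCast]
  exact div_mul_pow_aux _ _ _ _ _ _ h2'.ne' hA hB

/-- **Factorisation on the cube.** With `R(y)` the first factor of `integrandJ_eq_factor` and `w₁, w₂` as there,
`R(y) · w₁^s · w₂^t` is the product of five Beta integrands (one per coordinate).
[cite: BrownZudilin2022, Sect. 5, (15) and p. 10 ("the Eulerian integral ∫₀^∞ z^(α−1) (1+z)^(−α−β) dz = Γ(α)Γ(β)/Γ(α+β), where Re α, Re β > 0")] -/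
theorem cube_factorisation (p : Fin 7 → ℤ) (q : Fin 5 → ℤ) {m₀ m₆ : ℕ} (hp0 : p 0 = m₀) (hp6 : p 6 = m₆)
    (s t : ℂ) {y : Fin 5 → ℝ} (hy : y ∈ openCube) :
    ((y 0 ^ (p 1) * (1 - y 0) ^ (q 0) * y 1 ^ (p 2) * (1 - y 1) ^ (q 1) * y 2 ^ (p 3 + 1) * (1 - y 2) ^ (q 2) *
          y 3 ^ (p 4) * (1 - y 3) ^ (q 3) * y 4 ^ (p 5) * (1 - y 4) ^ (q 4) /
          ((1 - y 2) ^ (m₀ + 1) * (1 - y 2) ^ (m₆ + 1)) : ℝ) : ℂ) *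
      (((y 2 * (y 0 * y 1) / (1 - y 2) : ℝ) : ℂ) ^ s * ((y 2 * (y 3 * y 4) / (1 - y 2) : ℝ) : ℂ) ^ t) =
    ((y 0 : ℂ) ^ ((p 1 : ℂ) + s) * (1 - (y 0 : ℂ)) ^ ((q 0 : ℂ))) *
    ((y 1 : ℂ) ^ ((p 2 : ℂ) + s) * (1 - (y 1 : ℂ)) ^ ((q 1 : ℂ))) *
    ((y 2 : ℂ) ^ ((p 3 : ℂ) + 1 + s + t) * (1 - (y 2 : ℂ)) ^ ((q 2 : ℂ) - (p 0 : ℂ) - (p 6 : ℂ) - 2 - s - t)) *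
    ((y 3 : ℂ) ^ ((p 4 : ℂ) + t) * (1 - (y 3 : ℂ)) ^ ((q 3 : ℂ))) *
    ((y 4 : ℂ) ^ ((p 5 : ℂ) + t) * (1 - (y 4 : ℂ)) ^ ((q 4 : ℂ))) := by
  have h0 := (hy 0).1; have h1 := (hy 1).1; have h2 := (hy 2).1; have h3 := (hy 3).1; have h4 := (hy 4).1
  have g0 := (hy 0).2; have g1 := (hy 1).2; have g2 := (hy 2).2; have g3 := (hy 3).2; have g4 := (hy 4).2
  have h0' : 0 < 1 - y 0 := by linarith
  have h1' : 0 < 1 - y 1 := by linarith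
  have h2' : 0 < 1 - y 2 := by linarith
  have h3' : 0 < 1 - y 3 := by linarith
  have h4' : 0 < 1 - y 4 := by linarith
  have hw1 : 0 < y 2 * (y 0 * y 1) / (1 - y 2) := by positivity
  have hw2 : 0 < y 2 * (y 3 * y 4) / (1 - y 2) := by positivity
  rw [hp0, hp6, cpow_ofReal_pos hw1, cpow_ofReal_pos hw2,
    Real.log_div (by positivity) h2'.ne', Real.log_mul h2.ne' (by positivity), Real.log_mul h0.ne' h1.ne',
    Real.log_div (by positivity) h2'.ne', Real.log_mul h2.ne' (by positivity), Real.log_mul h3.ne' h4.ne']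
  simp only [Complex.ofReal_mul, Complex.ofReal_inv, zpow_ofReal_eq_exp h0, zpow_ofReal_eq_exp h1,
    zpow_ofReal_eq_exp h2, zpow_ofReal_eq_exp h3, zpow_ofReal_eq_exp h4, zpow_ofReal_eq_exp h0',
    zpow_ofReal_eq_exp h1', zpow_ofReal_eq_exp h2', zpow_ofReal_eq_exp h3', zpow_ofReal_eq_exp h4',
    pow_ofReal_eq_exp h2', cpow_ofReal_pos h0, cpow_ofReal_pos h1, cpow_ofReal_pos h2,
    cpow_ofReal_pos h3, cpow_ofReal_pos h4, one_sub_cpow_eq_exp g0, one_sub_cpow_eq_exp g1,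
    one_sub_cpow_eq_exp g2, one_sub_cpow_eq_exp g3, one_sub_cpow_eq_exp g4,
    div_eq_mul_inv, mul_inv, ← Complex.exp_neg, ← Complex.exp_add]
  congr 1
  push_cast
  ring


/-! ### 5. The six chamber inequalities and the cube integral of the factorised integrand -/

/-- The plain inequalities packed in `Chamber`.
[cite: BrownZudilin2022, Sect. 5, (15) and p. 10 ("the Eulerian integral ∫₀^∞ z^(α−1) (1+z)^(−α−β) dz = Γ(α)Γ(β)/Γ(α+β), where Re α, Re β > 0")] -/
theorem chamber_bounds {p : Fin 7 → ℤ} {q : Fin 5 → ℤ} {c₁ c₂ : ℝ} (h : Chamber p q c₁ c₂) :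
    0 < c₁ ∧ c₁ < 1 + (p 0 : ℝ) ∧ c₁ < 1 + (p 1 : ℝ) ∧ c₁ < 1 + (p 2 : ℝ) ∧ 0 < c₂ ∧ c₂ < 1 + (p 4 : ℝ) ∧
      c₂ < 1 + (p 5 : ℝ) ∧ c₂ < 1 + (p 6 : ℝ) ∧ (1 : ℝ) + p 0 + p 6 - q 2 < c₁ + c₂ ∧ c₁ + c₂ < (p 3 : ℝ) + 2 := by
  obtain ⟨h1, h2, h3, h4, h5, h6⟩ := h
  have m1 : (min (p 0) (min (p 1) (p 2)) : ℝ) ≤ (p 0 : ℝ) := by exact_mod_cast min_le_left _ _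
  have m2 : (min (p 0) (min (p 1) (p 2)) : ℝ) ≤ (p 1 : ℝ) := by
    exact_mod_cast (min_le_right _ _).trans (min_le_left _ _)
  have m3 : (min (p 0) (min (p 1) (p 2)) : ℝ) ≤ (p 2 : ℝ) := by
    exact_mod_cast (min_le_right _ _).trans (min_le_right _ _)
  have m4 : (min (p 4) (min (p 5) (p 6)) : ℝ) ≤ (p 4 : ℝ) := by exact_mod_cast min_le_left _ _
  have m5 : (min (p 4) (min (p 5) (p 6)) : ℝ) ≤ (p 5 : ℝ) := by
    exact_mod_cast (min_le_right _ _).trans (min_le_left _ _)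
  have m6 : (min (p 4) (min (p 5) (p 6)) : ℝ) ≤ (p 6 : ℝ) := by
    exact_mod_cast (min_le_right _ _).trans (min_le_right _ _)
  push_cast at h2 h4
  refine ⟨h1, by linarith, by linarith, by linarith, h3, by linarith, by linarith, by linarith, h5, h6⟩

/-- **The cube integral of the factorised integrand** is a product of five Beta values: for `(c₁,c₂)` in the
chamber and `s = −c₁+iy₁`, `t = −c₂+iy₂`,
`∫_{(0,1)⁵} ∏ᵢ fᵢ = [Γ(p₁+1+s)Γ(q₁+1)/Γ(p₁+q₁+2+s)] [Γ(p₂+1+s)Γ(q₂+1)/Γ(p₂+q₂+2+s)]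
 [Γ(p₃+2+s+t)Γ(q₃−p₀−p₆−1−s−t)/Γ(p₃+q₃−p₀−p₆+1)] [Γ(p₄+1+t)Γ(q₄+1)/Γ(p₄+q₄+2+t)] [Γ(p₅+1+t)Γ(q₅+1)/Γ(p₅+q₅+2+t)]`
(printed indices; "the Eulerian integral `∫₀^∞ z^{α−1}(1+z)^{−α−β}dz = Γ(α)Γ(β)/Γ(α+β)`" of [BrownZudilin2022,
Sect. 5] is the middle factor, here taken over `(0,1)` in the variable `y₃`).
[cite: BrownZudilin2022, Sect. 5, (15) and p. 10 ("the Eulerian integral ∫₀^∞ z^(α−1) (1+z)^(−α−β) dz = Γ(α)Γ(β)/Γ(α+β), where Re α, Re β > 0")] -/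
theorem integral_cube_factor (p : Fin 7 → ℤ) (q : Fin 5 → ℤ) (hq : ∀ j, 0 ≤ q j) {c₁ c₂ : ℝ}
    (hch : Chamber p q c₁ c₂) (y₁ y₂ : ℝ) :
    ∫ y in openCube,
      ((y 0 : ℂ) ^ ((p 1 : ℂ) + (-(c₁ : ℂ) + (y₁ : ℂ) * Complex.I)) * (1 - (y 0 : ℂ)) ^ ((q 0 : ℂ))) *
      ((y 1 : ℂ) ^ ((p 2 : ℂ) + (-(c₁ : ℂ) + (y₁ : ℂ) * Complex.I)) * (1 - (y 1 : ℂ)) ^ ((q 1 : ℂ))) *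
      ((y 2 : ℂ) ^ ((p 3 : ℂ) + 1 + (-(c₁ : ℂ) + (y₁ : ℂ) * Complex.I) + (-(c₂ : ℂ) + (y₂ : ℂ) * Complex.I)) *
        (1 - (y 2 : ℂ)) ^ ((q 2 : ℂ) - (p 0 : ℂ) - (p 6 : ℂ) - 2 - (-(c₁ : ℂ) + (y₁ : ℂ) * Complex.I) -
          (-(c₂ : ℂ) + (y₂ : ℂ) * Complex.I))) *
      ((y 3 : ℂ) ^ ((p 4 : ℂ) + (-(c₂ : ℂ) + (y₂ : ℂ) * Complex.I)) * (1 - (y 3 : ℂ)) ^ ((q 3 : ℂ))) *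
      ((y 4 : ℂ) ^ ((p 5 : ℂ) + (-(c₂ : ℂ) + (y₂ : ℂ) * Complex.I)) * (1 - (y 4 : ℂ)) ^ ((q 4 : ℂ))) =
    (Complex.Gamma ((p 1 : ℂ) + 1 + (-(c₁ : ℂ) + (y₁ : ℂ) * Complex.I)) * Complex.Gamma ((q 0 : ℂ) + 1) /
        Complex.Gamma ((p 1 : ℂ) + (q 0 : ℂ) + 2 + (-(c₁ : ℂ) + (y₁ : ℂ) * Complex.I))) *
    (Complex.Gamma ((p 2 : ℂ) + 1 + (-(c₁ : ℂ) + (y₁ : ℂ) * Complex.I)) * Complex.Gamma ((q 1 : ℂ) + 1) /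
        Complex.Gamma ((p 2 : ℂ) + (q 1 : ℂ) + 2 + (-(c₁ : ℂ) + (y₁ : ℂ) * Complex.I))) *
    (Complex.Gamma ((p 3 : ℂ) + 2 + (-(c₁ : ℂ) + (y₁ : ℂ) * Complex.I) + (-(c₂ : ℂ) + (y₂ : ℂ) * Complex.I)) *
        Complex.Gamma ((q 2 : ℂ) - (p 0 : ℂ) - (p 6 : ℂ) - 1 - (-(c₁ : ℂ) + (y₁ : ℂ) * Complex.I) -
          (-(c₂ : ℂ) + (y₂ : ℂ) * Complex.I)) / Complex.Gamma ((p 3 : ℂ) + (q 2 : ℂ) - (p 0 : ℂ) - (p 6 : ℂ) + 1)) *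
    (Complex.Gamma ((p 4 : ℂ) + 1 + (-(c₂ : ℂ) + (y₂ : ℂ) * Complex.I)) * Complex.Gamma ((q 3 : ℂ) + 1) /
        Complex.Gamma ((p 4 : ℂ) + (q 3 : ℂ) + 2 + (-(c₂ : ℂ) + (y₂ : ℂ) * Complex.I))) *
    (Complex.Gamma ((p 5 : ℂ) + 1 + (-(c₂ : ℂ) + (y₂ : ℂ) * Complex.I)) * Complex.Gamma ((q 4 : ℂ) + 1) /
        Complex.Gamma ((p 5 : ℂ) + (q 4 : ℂ) + 2 + (-(c₂ : ℂ) + (y₂ : ℂ) * Complex.I))) := by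
  obtain ⟨hc1, b0, b1, b2, hc2, b4, b5, b6, hlo, hhi⟩ := chamber_bounds hch
  have hq0 : (0:ℝ) ≤ q 0 := by exact_mod_cast hq 0
  have hq1 : (0:ℝ) ≤ q 1 := by exact_mod_cast hq 1
  have hq3 : (0:ℝ) ≤ q 3 := by exact_mod_cast hq 3
  have hq4 : (0:ℝ) ≤ q 4 := by exact_mod_cast hq 4
  set s : ℂ := -(c₁ : ℂ) + (y₁ : ℂ) * Complex.I with hs_def
  set t : ℂ := -(c₂ : ℂ) + (y₂ : ℂ) * Complex.I with ht_def
  have hs : s.re = -c₁ := by simp [hs_def]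
  have ht : t.re = -c₂ := by simp [ht_def]
  rw [integral_openCube_prod5 (fun x : ℝ => (x : ℂ) ^ ((p 1 : ℂ) + s) * (1 - (x : ℂ)) ^ ((q 0 : ℂ)))
      (fun x : ℝ => (x : ℂ) ^ ((p 2 : ℂ) + s) * (1 - (x : ℂ)) ^ ((q 1 : ℂ)))
      (fun x : ℝ => (x : ℂ) ^ ((p 3 : ℂ) + 1 + s + t) * (1 - (x : ℂ)) ^ ((q 2 : ℂ) - (p 0 : ℂ) - (p 6 : ℂ) - 2 - s - t))
      (fun x : ℝ => (x : ℂ) ^ ((p 4 : ℂ) + t) * (1 - (x : ℂ)) ^ ((q 3 : ℂ)))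
      (fun x : ℝ => (x : ℂ) ^ ((p 5 : ℂ) + t) * (1 - (x : ℂ)) ^ ((q 4 : ℂ))),
    integral_beta_Ioo' (by simp [hs]; linarith) (by simp; linarith),
    integral_beta_Ioo' (by simp [hs]; linarith) (by simp; linarith),
    integral_beta_Ioo' (by simp [hs, ht]; linarith) (by simp [hs, ht]; linarith),
    integral_beta_Ioo' (by simp [ht]; linarith) (by simp; linarith),
    integral_beta_Ioo' (by simp [ht]; linarith) (by simp; linarith)]
  have e1 : (p 1 : ℂ) + s + (q 0 : ℂ) + 2 = (p 1 : ℂ) + (q 0 : ℂ) + 2 + s := by ring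
  have e2 : (p 2 : ℂ) + s + (q 1 : ℂ) + 2 = (p 2 : ℂ) + (q 1 : ℂ) + 2 + s := by ring
  have e3 : (p 3 : ℂ) + 1 + s + t + 1 = (p 3 : ℂ) + 2 + s + t := by ring
  have e3' : (q 2 : ℂ) - (p 0 : ℂ) - (p 6 : ℂ) - 2 - s - t + 1 = (q 2 : ℂ) - (p 0 : ℂ) - (p 6 : ℂ) - 1 - s - t := by ring
  have e3'' : (p 3 : ℂ) + 1 + s + t + ((q 2 : ℂ) - (p 0 : ℂ) - (p 6 : ℂ) - 2 - s - t) + 2 =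
      (p 3 : ℂ) + (q 2 : ℂ) - (p 0 : ℂ) - (p 6 : ℂ) + 1 := by ring
  have e4 : (p 4 : ℂ) + t + (q 3 : ℂ) + 2 = (p 4 : ℂ) + (q 3 : ℂ) + 2 + t := by ring
  have e5 : (p 5 : ℂ) + t + (q 4 : ℂ) + 2 = (p 5 : ℂ) + (q 4 : ℂ) + 2 + t := by ring
  have e1a : (p 1 : ℂ) + s + 1 = (p 1 : ℂ) + 1 + s := by ring
  have e2a : (p 2 : ℂ) + s + 1 = (p 2 : ℂ) + 1 + s := by ring
  have e4a : (p 4 : ℂ) + t + 1 = (p 4 : ℂ) + 1 + t := by ring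
  have e5a : (p 5 : ℂ) + t + 1 = (p 5 : ℂ) + 1 + t := by ring
  rw [e1, e2, e3, e3', e3'', e4, e5, e1a, e2a, e4a, e5a]

/-- The factorised integrand is integrable on the open cube (same chamber conditions).
[cite: BrownZudilin2022, Sect. 5, (15) and p. 10 ("the Eulerian integral ∫₀^∞ z^(α−1) (1+z)^(−α−β) dz = Γ(α)Γ(β)/Γ(α+β), where Re α, Re β > 0")] -/
theorem integrableOn_cube_factor (p : Fin 7 → ℤ) (q : Fin 5 → ℤ) (hq : ∀ j, 0 ≤ q j) {c₁ c₂ : ℝ}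
    (hch : Chamber p q c₁ c₂) (y₁ y₂ : ℝ) :
    IntegrableOn (fun y : Fin 5 → ℝ =>
      ((y 0 : ℂ) ^ ((p 1 : ℂ) + (-(c₁ : ℂ) + (y₁ : ℂ) * Complex.I)) * (1 - (y 0 : ℂ)) ^ ((q 0 : ℂ))) *
      ((y 1 : ℂ) ^ ((p 2 : ℂ) + (-(c₁ : ℂ) + (y₁ : ℂ) * Complex.I)) * (1 - (y 1 : ℂ)) ^ ((q 1 : ℂ))) *
      ((y 2 : ℂ) ^ ((p 3 : ℂ) + 1 + (-(c₁ : ℂ) + (y₁ : ℂ) * Complex.I) + (-(c₂ : ℂ) + (y₂ : ℂ) * Complex.I)) *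
        (1 - (y 2 : ℂ)) ^ ((q 2 : ℂ) - (p 0 : ℂ) - (p 6 : ℂ) - 2 - (-(c₁ : ℂ) + (y₁ : ℂ) * Complex.I) -
          (-(c₂ : ℂ) + (y₂ : ℂ) * Complex.I))) *
      ((y 3 : ℂ) ^ ((p 4 : ℂ) + (-(c₂ : ℂ) + (y₂ : ℂ) * Complex.I)) * (1 - (y 3 : ℂ)) ^ ((q 3 : ℂ))) *
      ((y 4 : ℂ) ^ ((p 5 : ℂ) + (-(c₂ : ℂ) + (y₂ : ℂ) * Complex.I)) * (1 - (y 4 : ℂ)) ^ ((q 4 : ℂ)))) openCube := by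
  obtain ⟨hc1, b0, b1, b2, hc2, b4, b5, b6, hlo, hhi⟩ := chamber_bounds hch
  have hq0 : (0:ℝ) ≤ q 0 := by exact_mod_cast hq 0
  have hq1 : (0:ℝ) ≤ q 1 := by exact_mod_cast hq 1
  have hq3 : (0:ℝ) ≤ q 3 := by exact_mod_cast hq 3
  have hq4 : (0:ℝ) ≤ q 4 := by exact_mod_cast hq 4
  set s : ℂ := -(c₁ : ℂ) + (y₁ : ℂ) * Complex.I with hs_def
  set t : ℂ := -(c₂ : ℂ) + (y₂ : ℂ) * Complex.I with ht_def
  have hs : s.re = -c₁ := by simp [hs_def]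
  have ht : t.re = -c₂ := by simp [ht_def]
  have h := integrable_openCube_prod5
    (f0 := fun x : ℝ => (x : ℂ) ^ ((p 1 : ℂ) + s) * (1 - (x : ℂ)) ^ ((q 0 : ℂ)))
    (f1 := fun x : ℝ => (x : ℂ) ^ ((p 2 : ℂ) + s) * (1 - (x : ℂ)) ^ ((q 1 : ℂ)))
    (f2 := fun x : ℝ => (x : ℂ) ^ ((p 3 : ℂ) + 1 + s + t) * (1 - (x : ℂ)) ^ ((q 2 : ℂ) - (p 0 : ℂ) - (p 6 : ℂ) - 2 - s - t))
    (f3 := fun x : ℝ => (x : ℂ) ^ ((p 4 : ℂ) + t) * (1 - (x : ℂ)) ^ ((q 3 : ℂ)))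
    (f4 := fun x : ℝ => (x : ℂ) ^ ((p 5 : ℂ) + t) * (1 - (x : ℂ)) ^ ((q 4 : ℂ)))
    (integrableOn_beta_Ioo' (by simp [hs]; linarith) (by simp; linarith))
    (integrableOn_beta_Ioo' (by simp [hs]; linarith) (by simp; linarith))
    (integrableOn_beta_Ioo' (by simp [hs, ht]; linarith) (by simp [hs, ht]; linarith))
    (integrableOn_beta_Ioo' (by simp [ht]; linarith) (by simp; linarith))
    (integrableOn_beta_Ioo' (by simp [ht]; linarith) (by simp; linarith))
  exact h

end Literature.NumberTheory.Irrationality.BrownZudilin2022.BarnesCube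

namespace Literature.NumberTheory.Irrationality.BrownZudilin2022.BarnesDouble

open MeasureTheory Set Filter
open scoped Real
open Literature.NumberTheory.Irrationality.BrownZudilin2022
open Literature.NumberTheory.Irrationality.BrownZudilin2022.CubicalSubstitution (openCube_eq_pi measurableSet_openCube)
open Literature.NumberTheory.Irrationality.BrownZudilin2022.BarnesMellin
open Literature.NumberTheory.Irrationality.BrownZudilin2022.BarnesCube

/-- The prefactor `q₁!q₂!q₄!q₅!/(p₀!p₆!(p₃+q₃−p₀−p₆)!)` of (16) is positive (a quotient of factorials).
[cite: BrownZudilin2022, Sect. 5, eq. (16) (p. 10)] -/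
theorem barnesPrefactor_pos (p : Fin 7 → ℤ) (q : Fin 5 → ℤ) : 0 < barnesPrefactor p q := by
  unfold barnesPrefactor
  positivity

/-- For an integer `z ≥ 0`, `Γ(z+1) = (z.toNat)!` in `ℂ` (the factorials of (16) as Gamma values). [folklore] -/
private theorem gamma_int_succ {z : ℤ} (hz : 0 ≤ z) : Complex.Gamma ((z : ℂ) + 1) = ((z.toNat.factorial : ℕ) : ℂ) := by
  obtain ⟨n, rfl⟩ := Int.eq_ofNat_of_zero_le hz
  rw [show ((n : ℤ) : ℂ) = (n : ℂ) by norm_cast, Complex.Gamma_nat_eq_factorial]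
  simp

/-! ### 1. Assembling the Gamma factors into the printed kernel and prefactor
(`Γ(z+1) = z!` for integers `z ≥ 0`: `gamma_int_succ`, copied in from the cell's `WedgeDictionaryKernelCells.lean`) -/

/-- **Kernel identity.** The five Beta values times the two Mellin–Barnes weights equal
`barnesPrefactor p q · barnesKernel p q s t`.
[cite: BrownZudilin2022, Sect. 5, eq. (16) (p. 10)] -/
theorem kernel_identity (p : Fin 7 → ℤ) (q : Fin 5 → ℤ) (hq : ∀ j, 0 ≤ q j)
    {m₀ m₆ : ℕ} (hp0 : p 0 = m₀) (hp6 : p 6 = m₆) {c₁ c₂ : ℝ} (hch : Chamber p q c₁ c₂) (s t : ℂ) :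
    (Complex.Gamma ((p 1 : ℂ) + 1 + s) * Complex.Gamma ((q 0 : ℂ) + 1) /
        Complex.Gamma ((p 1 : ℂ) + (q 0 : ℂ) + 2 + s)) *
    (Complex.Gamma ((p 2 : ℂ) + 1 + s) * Complex.Gamma ((q 1 : ℂ) + 1) /
        Complex.Gamma ((p 2 : ℂ) + (q 1 : ℂ) + 2 + s)) *
    (Complex.Gamma ((p 3 : ℂ) + 2 + s + t) * Complex.Gamma ((q 2 : ℂ) - (p 0 : ℂ) - (p 6 : ℂ) - 1 - s - t) /
        Complex.Gamma ((p 3 : ℂ) + (q 2 : ℂ) - (p 0 : ℂ) - (p 6 : ℂ) + 1)) *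
    (Complex.Gamma ((p 4 : ℂ) + 1 + t) * Complex.Gamma ((q 3 : ℂ) + 1) /
        Complex.Gamma ((p 4 : ℂ) + (q 3 : ℂ) + 2 + t)) *
    (Complex.Gamma ((p 5 : ℂ) + 1 + t) * Complex.Gamma ((q 4 : ℂ) + 1) /
        Complex.Gamma ((p 5 : ℂ) + (q 4 : ℂ) + 2 + t)) *
    ((Complex.Gamma ((m₀ : ℂ) + 1 + s) * Complex.Gamma (-s) / (m₀.factorial : ℂ)) *
      (Complex.Gamma ((m₆ : ℂ) + 1 + t) * Complex.Gamma (-t) / (m₆.factorial : ℂ))) =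
    (barnesPrefactor p q : ℂ) * barnesKernel p q s t := by
  obtain ⟨hc1, b0, b1, b2, hc2, b4, b5, b6, hlo, hhi⟩ := chamber_bounds hch
  have hD : 0 ≤ p 3 + q 2 - p 0 - p 6 := by
    have h' : ((p 0 + p 6 - q 2 - p 3 : ℤ) : ℝ) < 1 := by push_cast; linarith
    have h'' : p 0 + p 6 - q 2 - p 3 < 1 := by exact_mod_cast h'
    omega
  have fD : Complex.Gamma ((p 3 : ℂ) + (q 2 : ℂ) - (p 0 : ℂ) - (p 6 : ℂ) + 1) =
      (((p 3 + q 2 - p 0 - p 6).toNat.factorial : ℕ) : ℂ) := by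
    have := gamma_int_succ hD
    push_cast at this
    exact this
  unfold barnesPrefactor barnesKernel
  rw [gamma_int_succ (hq 0), gamma_int_succ (hq 1), gamma_int_succ (hq 3),
    gamma_int_succ (hq 4), fD]
  have hm0 : (p 0).toNat = m₀ := by rw [hp0, Int.toNat_natCast]
  have hm6 : (p 6).toNat = m₆ := by rw [hp6, Int.toNat_natCast]
  have hp0' : ((p 0 : ℤ) : ℂ) = (m₀ : ℂ) := by rw [hp0, Int.cast_natCast]
  have hp6' : ((p 6 : ℤ) : ℂ) = (m₆ : ℂ) := by rw [hp6, Int.cast_natCast]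
  rw [hm0, hm6, hp0', hp6']
  push_cast
  ring

/-! ### 2. Two Mellin–Barnes integrals at once -/

/-- Opening both denominators: for `R ∈ ℝ`, `w₁, w₂ > 0` and `0 < cᵢ < mᵢ+1`,
`R (1+w₁)^{-(m₀+1)} (1+w₂)^{-(m₆+1)} = (1/2π)² ∫∫_{ℝ²} R · w₁^s w₂^t · G₁(s) G₂(t)`,
`s = −c₁+iy₁`, `t = −c₂+iy₂`, `G(s) = Γ(m+1+s)Γ(−s)/m!` (two copies of `BarnesMellin.mellin_barnes` and Fubini for
a product).
[cite: BrownZudilin2022, Sect. 5, eq. (16) (p. 10)] -/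
theorem mb_pair (m₀ m₆ : ℕ) {c₁ c₂ : ℝ} (hc1 : 0 < c₁) (hc1' : c₁ < m₀ + 1) (hc2 : 0 < c₂) (hc2' : c₂ < m₆ + 1)
    (R : ℝ) {w₁ w₂ : ℝ} (hw1 : 0 < w₁) (hw2 : 0 < w₂) :
    (((R * (((1 + w₁) ^ (m₀ + 1))⁻¹ * ((1 + w₂) ^ (m₆ + 1))⁻¹)) : ℝ) : ℂ) =
      (1 / (2 * π) : ℂ) ^ 2 * ∫ η : ℝ × ℝ, (R : ℂ) *
        ((w₁ : ℂ) ^ (-(c₁ : ℂ) + (η.1 : ℂ) * Complex.I) * (w₂ : ℂ) ^ (-(c₂ : ℂ) + (η.2 : ℂ) * Complex.I)) *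
        ((Complex.Gamma ((m₀ : ℂ) + 1 + (-(c₁ : ℂ) + (η.1 : ℂ) * Complex.I)) *
            Complex.Gamma (-(-(c₁ : ℂ) + (η.1 : ℂ) * Complex.I)) / (m₀.factorial : ℂ)) *
          (Complex.Gamma ((m₆ : ℂ) + 1 + (-(c₂ : ℂ) + (η.2 : ℂ) * Complex.I)) *
            Complex.Gamma (-(-(c₂ : ℂ) + (η.2 : ℂ) * Complex.I)) / (m₆.factorial : ℂ))) := by
  push_cast
  rw [mellin_barnes m₀ hw1 hc1 hc1', mellin_barnes m₆ hw2 hc2 hc2']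
  set f1 : ℝ → ℂ := fun y => (w₁ : ℂ) ^ (-(c₁ : ℂ) + (y : ℂ) * Complex.I) *
        (Complex.Gamma ((m₀ : ℂ) + 1 + (-(c₁ : ℂ) + (y : ℂ) * Complex.I)) *
          Complex.Gamma (-(-(c₁ : ℂ) + (y : ℂ) * Complex.I)) / (m₀.factorial : ℂ)) with hf1
  set g1 : ℝ → ℂ := fun y => (w₂ : ℂ) ^ (-(c₂ : ℂ) + (y : ℂ) * Complex.I) *
        (Complex.Gamma ((m₆ : ℂ) + 1 + (-(c₂ : ℂ) + (y : ℂ) * Complex.I)) *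
          Complex.Gamma (-(-(c₂ : ℂ) + (y : ℂ) * Complex.I)) / (m₆.factorial : ℂ)) with hg1
  have hprod : (∫ y : ℝ, f1 y) * (∫ y : ℝ, g1 y) = ∫ η : ℝ × ℝ, f1 η.1 * g1 η.2 := by
    rw [Measure.volume_eq_prod, integral_prod_mul]
  have hre : ∫ η : ℝ × ℝ, (R : ℂ) *
        ((w₁ : ℂ) ^ (-(c₁ : ℂ) + (η.1 : ℂ) * Complex.I) * (w₂ : ℂ) ^ (-(c₂ : ℂ) + (η.2 : ℂ) * Complex.I)) *
        ((Complex.Gamma ((m₀ : ℂ) + 1 + (-(c₁ : ℂ) + (η.1 : ℂ) * Complex.I)) *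
            Complex.Gamma (-(-(c₁ : ℂ) + (η.1 : ℂ) * Complex.I)) / (m₀.factorial : ℂ)) *
          (Complex.Gamma ((m₆ : ℂ) + 1 + (-(c₂ : ℂ) + (η.2 : ℂ) * Complex.I)) *
            Complex.Gamma (-(-(c₂ : ℂ) + (η.2 : ℂ) * Complex.I)) / (m₆.factorial : ℂ))) =
      (R : ℂ) * ∫ η : ℝ × ℝ, f1 η.1 * g1 η.2 := by
    rw [← integral_const_mul]
    congr 1
    funext η
    simp only [hf1, hg1]
    ring
  rw [hre, ← hprod]
  ring

/-! ### 3. Absolute convergence of the joint integrand on `(0,1)⁵ × ℝ²` -/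

/-- **Fubini input.** After opening both denominators, the joint integrand
`H(y,η) = R(y) · w₁^s w₂^t · G₁(s)G₂(t)` is integrable on `(0,1)⁵ × ℝ²` (for `(c₁,c₂)` in the chamber): its norm is
the product of the factorised Beta integrand at `η = 0` (integrable on the cube) and of `‖G₁‖‖G₂‖` (integrable on `ℝ²`
by the exponential decay of `Γ` on vertical lines).
[cite: BrownZudilin2022, Sect. 5, eq. (16) (p. 10)] -/
theorem integrable_joint (p : Fin 7 → ℤ) (q : Fin 5 → ℤ) (hq : ∀ j, 0 ≤ q j) {m₀ m₆ : ℕ}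
    (hp0 : p 0 = m₀) (hp6 : p 6 = m₆) {c₁ c₂ : ℝ} (hch : Chamber p q c₁ c₂) :
    Integrable (Function.uncurry fun (y : Fin 5 → ℝ) (η : ℝ × ℝ) =>
      ((y 0 ^ (p 1) * (1 - y 0) ^ (q 0) * y 1 ^ (p 2) * (1 - y 1) ^ (q 1) * y 2 ^ (p 3 + 1) * (1 - y 2) ^ (q 2) *
          y 3 ^ (p 4) * (1 - y 3) ^ (q 3) * y 4 ^ (p 5) * (1 - y 4) ^ (q 4) /
          ((1 - y 2) ^ (m₀ + 1) * (1 - y 2) ^ (m₆ + 1)) : ℝ) : ℂ) *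
      ((((y 2 * (y 0 * y 1) / (1 - y 2) : ℝ)) : ℂ) ^ (-(c₁ : ℂ) + (η.1 : ℂ) * Complex.I) *
        (((y 2 * (y 3 * y 4) / (1 - y 2) : ℝ)) : ℂ) ^ (-(c₂ : ℂ) + (η.2 : ℂ) * Complex.I)) *
      ((Complex.Gamma ((m₀ : ℂ) + 1 + (-(c₁ : ℂ) + (η.1 : ℂ) * Complex.I)) *
          Complex.Gamma (-(-(c₁ : ℂ) + (η.1 : ℂ) * Complex.I)) / (m₀.factorial : ℂ)) *
        (Complex.Gamma ((m₆ : ℂ) + 1 + (-(c₂ : ℂ) + (η.2 : ℂ) * Complex.I)) *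
          Complex.Gamma (-(-(c₂ : ℂ) + (η.2 : ℂ) * Complex.I)) / (m₆.factorial : ℂ))))
      (((volume : Measure (Fin 5 → ℝ)).restrict openCube).prod (volume : Measure (ℝ × ℝ))) := by
  obtain ⟨hc1, b0, b1, b2, hc2, b4, b5, b6, hlo, hhi⟩ := chamber_bounds hch
  have hc1' : c₁ < (m₀ : ℝ) + 1 := by rw [hp0] at b0; push_cast at b0; linarith
  have hc2' : c₂ < (m₆ : ℝ) + 1 := by rw [hp6] at b6; push_cast at b6; linarith
  -- (a) measurability
  have hRm : Measurable fun y : Fin 5 → ℝ =>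
      y 0 ^ (p 1) * (1 - y 0) ^ (q 0) * y 1 ^ (p 2) * (1 - y 1) ^ (q 1) * y 2 ^ (p 3 + 1) * (1 - y 2) ^ (q 2) *
          y 3 ^ (p 4) * (1 - y 3) ^ (q 3) * y 4 ^ (p 5) * (1 - y 4) ^ (q 4) /
          ((1 - y 2) ^ (m₀ + 1) * (1 - y 2) ^ (m₆ + 1)) := by fun_prop
  have hW1m : Measurable fun y : Fin 5 → ℝ => y 2 * (y 0 * y 1) / (1 - y 2) := by fun_prop
  have hW2m : Measurable fun y : Fin 5 → ℝ => y 2 * (y 3 * y 4) / (1 - y 2) := by fun_prop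
  have hG1m : Measurable fun y₁ : ℝ => Complex.Gamma ((m₀ : ℂ) + 1 + (-(c₁ : ℂ) + (y₁ : ℂ) * Complex.I)) *
      Complex.Gamma (-(-(c₁ : ℂ) + (y₁ : ℂ) * Complex.I)) / (m₀.factorial : ℂ) :=
    ((continuous_Gamma_vertical' m₀ hc1 hc1').div_const _).measurable
  have hG2m : Measurable fun y₂ : ℝ => Complex.Gamma ((m₆ : ℂ) + 1 + (-(c₂ : ℂ) + (y₂ : ℂ) * Complex.I)) *
      Complex.Gamma (-(-(c₂ : ℂ) + (y₂ : ℂ) * Complex.I)) / (m₆.factorial : ℂ) :=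
    ((continuous_Gamma_vertical' m₆ hc2 hc2').div_const _).measurable
  have hs1 : Measurable fun z : (Fin 5 → ℝ) × (ℝ × ℝ) => -(c₁ : ℂ) + (z.2.1 : ℂ) * Complex.I := by fun_prop
  have hs2 : Measurable fun z : (Fin 5 → ℝ) × (ℝ × ℝ) => -(c₂ : ℂ) + (z.2.2 : ℂ) * Complex.I := by fun_prop
  have hmeas : Measurable (Function.uncurry fun (y : Fin 5 → ℝ) (η : ℝ × ℝ) =>
      ((y 0 ^ (p 1) * (1 - y 0) ^ (q 0) * y 1 ^ (p 2) * (1 - y 1) ^ (q 1) * y 2 ^ (p 3 + 1) * (1 - y 2) ^ (q 2) *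
          y 3 ^ (p 4) * (1 - y 3) ^ (q 3) * y 4 ^ (p 5) * (1 - y 4) ^ (q 4) /
          ((1 - y 2) ^ (m₀ + 1) * (1 - y 2) ^ (m₆ + 1)) : ℝ) : ℂ) *
      ((((y 2 * (y 0 * y 1) / (1 - y 2) : ℝ)) : ℂ) ^ (-(c₁ : ℂ) + (η.1 : ℂ) * Complex.I) *
        (((y 2 * (y 3 * y 4) / (1 - y 2) : ℝ)) : ℂ) ^ (-(c₂ : ℂ) + (η.2 : ℂ) * Complex.I)) *
      ((Complex.Gamma ((m₀ : ℂ) + 1 + (-(c₁ : ℂ) + (η.1 : ℂ) * Complex.I)) *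
          Complex.Gamma (-(-(c₁ : ℂ) + (η.1 : ℂ) * Complex.I)) / (m₀.factorial : ℂ)) *
        (Complex.Gamma ((m₆ : ℂ) + 1 + (-(c₂ : ℂ) + (η.2 : ℂ) * Complex.I)) *
          Complex.Gamma (-(-(c₂ : ℂ) + (η.2 : ℂ) * Complex.I)) / (m₆.factorial : ℂ)))) :=
    ((Complex.measurable_ofReal.comp (hRm.comp measurable_fst)).mul
      (((Complex.measurable_ofReal.comp (hW1m.comp measurable_fst)).pow hs1).mul
        ((Complex.measurable_ofReal.comp (hW2m.comp measurable_fst)).pow hs2))).mul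
      ((hG1m.comp (measurable_fst.comp measurable_snd)).mul (hG2m.comp (measurable_snd.comp measurable_snd)))
  -- (b) domination by a product of integrable functions
  have hΦ := (integrableOn_cube_factor p q hq hch 0 0).norm
  have hΨ : Integrable (fun η : ℝ × ℝ => ‖Complex.Gamma ((m₀ : ℂ) + 1 + (-(c₁ : ℂ) + (η.1 : ℂ) * Complex.I)) *
      Complex.Gamma (-(-(c₁ : ℂ) + (η.1 : ℂ) * Complex.I)) / (m₀.factorial : ℂ)‖ *
      ‖Complex.Gamma ((m₆ : ℂ) + 1 + (-(c₂ : ℂ) + (η.2 : ℂ) * Complex.I)) *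
      Complex.Gamma (-(-(c₂ : ℂ) + (η.2 : ℂ) * Complex.I)) / (m₆.factorial : ℂ)‖) := by
    have h1 := ((integrable_Gamma_vertical' m₀ hc1 hc1').div_const (m₀.factorial : ℂ)).norm
    have h2 := ((integrable_Gamma_vertical' m₆ hc2 hc2').div_const (m₆.factorial : ℂ)).norm
    rw [Measure.volume_eq_prod]
    exact h1.mul_prod h2
  refine Integrable.mono' (hΦ.mul_prod hΨ) hmeas.aestronglyMeasurable ?_
  have hμ : (((volume : Measure (Fin 5 → ℝ)).restrict openCube).prod (volume : Measure (ℝ × ℝ))) =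
      ((volume : Measure (Fin 5 → ℝ)).prod (volume : Measure (ℝ × ℝ))).restrict (openCube ×ˢ univ) := by
    rw [← Measure.prod_restrict, Measure.restrict_univ]
  rw [hμ]
  refine ae_restrict_of_forall_mem (measurableSet_openCube.prod MeasurableSet.univ) ?_
  rintro ⟨y, η⟩ ⟨hy, -⟩
  have h0 := (hy 0).1; have h1 := (hy 1).1; have h2 := (hy 2).1; have h3 := (hy 3).1; have h4 := (hy 4).1
  have h2' : 0 < 1 - y 2 := by linarith [(hy 2).2]
  have hw1 : 0 < y 2 * (y 0 * y 1) / (1 - y 2) := by positivity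
  have hw2 : 0 < y 2 * (y 3 * y 4) / (1 - y 2) := by positivity
  simp only [Function.uncurry_apply_pair]
  rw [← cube_factorisation p q hp0 hp6 (-(c₁ : ℂ) + ((0:ℝ) : ℂ) * Complex.I) (-(c₂ : ℂ) + ((0:ℝ) : ℂ) * Complex.I) hy]
  simp only [norm_mul, Complex.norm_cpow_eq_rpow_re_of_pos hw1, Complex.norm_cpow_eq_rpow_re_of_pos hw2]
  simp

/-! ### 4. The theorem -/

/-- The inner (cube) integral of `H(·, η)` is `barnesPrefactor p q · barnesKernel p q s t`.
[cite: BrownZudilin2022, Sect. 5, eq. (16) (p. 10)] -/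
theorem inner_integral (p : Fin 7 → ℤ) (q : Fin 5 → ℤ) (hq : ∀ j, 0 ≤ q j) {m₀ m₆ : ℕ}
    (hp0 : p 0 = m₀) (hp6 : p 6 = m₆) {c₁ c₂ : ℝ} (hch : Chamber p q c₁ c₂) (η : ℝ × ℝ) :
    ∫ y in openCube, ((y 0 ^ (p 1) * (1 - y 0) ^ (q 0) * y 1 ^ (p 2) * (1 - y 1) ^ (q 1) * y 2 ^ (p 3 + 1) * (1 - y 2) ^ (q 2) *
          y 3 ^ (p 4) * (1 - y 3) ^ (q 3) * y 4 ^ (p 5) * (1 - y 4) ^ (q 4) /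
          ((1 - y 2) ^ (m₀ + 1) * (1 - y 2) ^ (m₆ + 1)) : ℝ) : ℂ) *
      ((((y 2 * (y 0 * y 1) / (1 - y 2) : ℝ)) : ℂ) ^ (-(c₁ : ℂ) + (η.1 : ℂ) * Complex.I) *
        (((y 2 * (y 3 * y 4) / (1 - y 2) : ℝ)) : ℂ) ^ (-(c₂ : ℂ) + (η.2 : ℂ) * Complex.I)) *
      ((Complex.Gamma ((m₀ : ℂ) + 1 + (-(c₁ : ℂ) + (η.1 : ℂ) * Complex.I)) *
          Complex.Gamma (-(-(c₁ : ℂ) + (η.1 : ℂ) * Complex.I)) / (m₀.factorial : ℂ)) *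
        (Complex.Gamma ((m₆ : ℂ) + 1 + (-(c₂ : ℂ) + (η.2 : ℂ) * Complex.I)) *
          Complex.Gamma (-(-(c₂ : ℂ) + (η.2 : ℂ) * Complex.I)) / (m₆.factorial : ℂ))) =
      (barnesPrefactor p q : ℂ) * barnesKernel p q (-(c₁ : ℂ) + (η.1 : ℂ) * Complex.I) (-(c₂ : ℂ) + (η.2 : ℂ) * Complex.I) := by
  have hpt : ∀ y ∈ openCube, ((y 0 ^ (p 1) * (1 - y 0) ^ (q 0) * y 1 ^ (p 2) * (1 - y 1) ^ (q 1) * y 2 ^ (p 3 + 1) * (1 - y 2) ^ (q 2) *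
          y 3 ^ (p 4) * (1 - y 3) ^ (q 3) * y 4 ^ (p 5) * (1 - y 4) ^ (q 4) /
          ((1 - y 2) ^ (m₀ + 1) * (1 - y 2) ^ (m₆ + 1)) : ℝ) : ℂ) *
      ((((y 2 * (y 0 * y 1) / (1 - y 2) : ℝ)) : ℂ) ^ (-(c₁ : ℂ) + (η.1 : ℂ) * Complex.I) *
        (((y 2 * (y 3 * y 4) / (1 - y 2) : ℝ)) : ℂ) ^ (-(c₂ : ℂ) + (η.2 : ℂ) * Complex.I)) *
      ((Complex.Gamma ((m₀ : ℂ) + 1 + (-(c₁ : ℂ) + (η.1 : ℂ) * Complex.I)) *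
          Complex.Gamma (-(-(c₁ : ℂ) + (η.1 : ℂ) * Complex.I)) / (m₀.factorial : ℂ)) *
        (Complex.Gamma ((m₆ : ℂ) + 1 + (-(c₂ : ℂ) + (η.2 : ℂ) * Complex.I)) *
          Complex.Gamma (-(-(c₂ : ℂ) + (η.2 : ℂ) * Complex.I)) / (m₆.factorial : ℂ))) =
      (((y 0 : ℂ) ^ ((p 1 : ℂ) + (-(c₁ : ℂ) + (η.1 : ℂ) * Complex.I)) * (1 - (y 0 : ℂ)) ^ ((q 0 : ℂ))) *
      ((y 1 : ℂ) ^ ((p 2 : ℂ) + (-(c₁ : ℂ) + (η.1 : ℂ) * Complex.I)) * (1 - (y 1 : ℂ)) ^ ((q 1 : ℂ))) *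
      ((y 2 : ℂ) ^ ((p 3 : ℂ) + 1 + (-(c₁ : ℂ) + (η.1 : ℂ) * Complex.I) + (-(c₂ : ℂ) + (η.2 : ℂ) * Complex.I)) *
        (1 - (y 2 : ℂ)) ^ ((q 2 : ℂ) - (p 0 : ℂ) - (p 6 : ℂ) - 2 - (-(c₁ : ℂ) + (η.1 : ℂ) * Complex.I) - (-(c₂ : ℂ) + (η.2 : ℂ) * Complex.I))) *
      ((y 3 : ℂ) ^ ((p 4 : ℂ) + (-(c₂ : ℂ) + (η.2 : ℂ) * Complex.I)) * (1 - (y 3 : ℂ)) ^ ((q 3 : ℂ))) *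
      ((y 4 : ℂ) ^ ((p 5 : ℂ) + (-(c₂ : ℂ) + (η.2 : ℂ) * Complex.I)) * (1 - (y 4 : ℂ)) ^ ((q 4 : ℂ)))) *
      ((Complex.Gamma ((m₀ : ℂ) + 1 + (-(c₁ : ℂ) + (η.1 : ℂ) * Complex.I)) *
          Complex.Gamma (-(-(c₁ : ℂ) + (η.1 : ℂ) * Complex.I)) / (m₀.factorial : ℂ)) *
        (Complex.Gamma ((m₆ : ℂ) + 1 + (-(c₂ : ℂ) + (η.2 : ℂ) * Complex.I)) *
          Complex.Gamma (-(-(c₂ : ℂ) + (η.2 : ℂ) * Complex.I)) / (m₆.factorial : ℂ))) := by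
    intro y hy
    rw [cube_factorisation p q hp0 hp6 _ _ hy]
  rw [setIntegral_congr_fun measurableSet_openCube hpt, integral_mul_const,
    integral_cube_factor p q hq hch η.1 η.2, kernel_identity p q hq hp0 hp6 hch]

end Literature.NumberTheory.Irrationality.BrownZudilin2022.BarnesDouble

namespace Literature.NumberTheory.Irrationality.BrownZudilin2022

open MeasureTheory Set Filter
open scoped Real
open BarnesMellin BarnesCube BarnesDouble
open CubicalSubstitution (openCube_eq_pi measurableSet_openCube)

/-- **Brown–Zudilin (16) holds**: the named fact `barnes_double` of `BarnesRepresentation.lean` is a theorem —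
for `p, q ≥ 0` and `(c₁,c₂)` in the chamber, the Barnes kernel is integrable on `Re s = −c₁`, `Re t = −c₂` and
`J(p;q) = q₁!q₂!q₄!q₅!/(p₀!p₆!(p₃+q₃−p₀−p₆)!) · (1/4π²) ∫∫ barnesKernel p q (−c₁+iy₁) (−c₂+iy₂) dy₁dy₂`.
[BrownZudilin2022, Sect. 5, eq. (16)]
[cite: BrownZudilin2022, Sect. 5, eq. (16) (p. 10)] -/
theorem barnes_double_holds : barnes_double := by
  intro p q c₁ c₂ hp hq hch
  obtain ⟨hc1, b0, b1, b2, hc2, b4, b5, b6, hlo, hhi⟩ := chamber_bounds hch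
  obtain ⟨m₀, hp0⟩ := Int.eq_ofNat_of_zero_le (hp 0)
  obtain ⟨m₆, hp6⟩ := Int.eq_ofNat_of_zero_le (hp 6)
  have hc1' : c₁ < (m₀ : ℝ) + 1 := by rw [hp0] at b0; push_cast at b0; linarith
  have hc2' : c₂ < (m₆ : ℝ) + 1 := by rw [hp6] at b6; push_cast at b6; linarith
  have hInt := integrable_joint p q hq hp0 hp6 hch
  have hK : (barnesPrefactor p q : ℂ) ≠ 0 := by exact_mod_cast (barnesPrefactor_pos p q).ne'
  refine ⟨?_, ?_⟩
  · -- integrability of the kernel on the contour: a Fubini marginal of the joint integrand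
    have h1 := hInt.integral_prod_right
    have h2 : Integrable (fun η : ℝ × ℝ => (barnesPrefactor p q : ℂ) *
        barnesKernel p q (-(c₁ : ℂ) + (η.1 : ℂ) * Complex.I) (-(c₂ : ℂ) + (η.2 : ℂ) * Complex.I)) := by
      refine h1.congr (Eventually.of_forall fun η => ?_)
      simp only [Function.uncurry_apply_pair]
      exact inner_integral p q hq hp0 hp6 hch η
    refine (h2.const_mul ((barnesPrefactor p q : ℂ)⁻¹)).congr (Eventually.of_forall fun η => ?_)
    simp only
    rw [← mul_assoc, inv_mul_cancel₀ hK, one_mul]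
  · -- the identity
    have e1 : (Jintegral p q : ℂ) = ∫ y in openCube, (integrandJ p q y : ℂ) := by
      rw [Jintegral]; exact integral_ofReal.symm
    have step1 : ∀ y ∈ openCube, (integrandJ p q y : ℂ) = (1 / (2 * π) : ℂ) ^ 2 * ∫ η : ℝ × ℝ,
        ((y 0 ^ (p 1) * (1 - y 0) ^ (q 0) * y 1 ^ (p 2) * (1 - y 1) ^ (q 1) * y 2 ^ (p 3 + 1) * (1 - y 2) ^ (q 2) *
          y 3 ^ (p 4) * (1 - y 3) ^ (q 3) * y 4 ^ (p 5) * (1 - y 4) ^ (q 4) /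
          ((1 - y 2) ^ (m₀ + 1) * (1 - y 2) ^ (m₆ + 1)) : ℝ) : ℂ) *
      ((((y 2 * (y 0 * y 1) / (1 - y 2) : ℝ)) : ℂ) ^ (-(c₁ : ℂ) + (η.1 : ℂ) * Complex.I) *
        (((y 2 * (y 3 * y 4) / (1 - y 2) : ℝ)) : ℂ) ^ (-(c₂ : ℂ) + (η.2 : ℂ) * Complex.I)) *
      ((Complex.Gamma ((m₀ : ℂ) + 1 + (-(c₁ : ℂ) + (η.1 : ℂ) * Complex.I)) *
          Complex.Gamma (-(-(c₁ : ℂ) + (η.1 : ℂ) * Complex.I)) / (m₀.factorial : ℂ)) *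
        (Complex.Gamma ((m₆ : ℂ) + 1 + (-(c₂ : ℂ) + (η.2 : ℂ) * Complex.I)) *
          Complex.Gamma (-(-(c₂ : ℂ) + (η.2 : ℂ) * Complex.I)) / (m₆.factorial : ℂ))) := by
      intro y hy
      have h0 := (hy 0).1; have h1 := (hy 1).1; have h2 := (hy 2).1; have h3 := (hy 3).1; have h4 := (hy 4).1
      have h2' : 0 < 1 - y 2 := by linarith [(hy 2).2]
      have hw1 : 0 < y 2 * (y 0 * y 1) / (1 - y 2) := by positivity
      have hw2 : 0 < y 2 * (y 3 * y 4) / (1 - y 2) := by positivity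
      rw [integrandJ_eq_factor p q hp0 hp6 hy]
      exact mb_pair m₀ m₆ hc1 hc1' hc2 hc2' _ hw1 hw2
    have e2 := setIntegral_congr_fun (μ := (volume : Measure (Fin 5 → ℝ))) measurableSet_openCube step1
    have e3 : ∫ y in openCube, (1 / (2 * π) : ℂ) ^ 2 * ∫ η : ℝ × ℝ,
        ((y 0 ^ (p 1) * (1 - y 0) ^ (q 0) * y 1 ^ (p 2) * (1 - y 1) ^ (q 1) * y 2 ^ (p 3 + 1) * (1 - y 2) ^ (q 2) *
          y 3 ^ (p 4) * (1 - y 3) ^ (q 3) * y 4 ^ (p 5) * (1 - y 4) ^ (q 4) /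
          ((1 - y 2) ^ (m₀ + 1) * (1 - y 2) ^ (m₆ + 1)) : ℝ) : ℂ) *
      ((((y 2 * (y 0 * y 1) / (1 - y 2) : ℝ)) : ℂ) ^ (-(c₁ : ℂ) + (η.1 : ℂ) * Complex.I) *
        (((y 2 * (y 3 * y 4) / (1 - y 2) : ℝ)) : ℂ) ^ (-(c₂ : ℂ) + (η.2 : ℂ) * Complex.I)) *
      ((Complex.Gamma ((m₀ : ℂ) + 1 + (-(c₁ : ℂ) + (η.1 : ℂ) * Complex.I)) *
          Complex.Gamma (-(-(c₁ : ℂ) + (η.1 : ℂ) * Complex.I)) / (m₀.factorial : ℂ)) *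
        (Complex.Gamma ((m₆ : ℂ) + 1 + (-(c₂ : ℂ) + (η.2 : ℂ) * Complex.I)) *
          Complex.Gamma (-(-(c₂ : ℂ) + (η.2 : ℂ) * Complex.I)) / (m₆.factorial : ℂ))) =
        (1 / (2 * π) : ℂ) ^ 2 * ((barnesPrefactor p q : ℂ) * ∫ η : ℝ × ℝ,
          barnesKernel p q (-(c₁ : ℂ) + (η.1 : ℂ) * Complex.I) (-(c₂ : ℂ) + (η.2 : ℂ) * Complex.I)) := by
      rw [integral_const_mul, integral_integral_swap hInt, ← integral_const_mul (barnesPrefactor p q : ℂ)]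
      congr 1
      refine integral_congr_ae (Eventually.of_forall fun η => ?_)
      exact inner_integral p q hq hp0 hp6 hch η
    rw [e1, e2, e3]
    set X := ∫ η : ℝ × ℝ, barnesKernel p q (-(c₁ : ℂ) + (η.1 : ℂ) * Complex.I) (-(c₂ : ℂ) + (η.2 : ℂ) * Complex.I)
    have hπ : (Real.pi : ℂ) ≠ 0 := by exact_mod_cast Real.pi_ne_zero
    field_simp
    ring

end Literature.NumberTheory.Irrationality.BrownZudilin2022

end
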